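import Literature.NumberTheory.LFunctions.RealZerosRealLFunctionsElementary
import Literature.NumberTheory.LFunctions.ExceptionalZeroLOneWidthProofs
import HarnessLib

/-!
# Pintz 1977 (VIII), Theorem 2 — Hecke's theorem with the constant `e^{−3/2}` — PROVED

Topic `Literature/NumberTheory/LFunctions` (namespace `Literature.NumberTheory.LFunctions`; the
re-usable general-length Riesz-mean kit in `FI2018` (Part A), Pintz-specific numerics in
`Pintz1977RealZeros` (Part B)). PROOF LAYER for the statement file
`RealZerosRealLFunctionsElementary.lean` (cells `parity-realchar` / `landau-siegel` §C): the named fact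

* `pintz1977RealZeros_theorem2` — J. Pintz, *Elementary methods in the theory of `L`-functions,
  VIII. Real zeros of real `L`-functions*, Acta Arith. **33** (1977) 89–98, Theorem 2 (Hecke):
  "If `χ` is a real non-principal character `(mod D)`, and `L(s, χ)` has no zero in the interval
  `[1 − β, 1]` with `0 < β ≤ 1/log D`, then `L(1, χ) > (1 + o(1)) e^{−3/2} β`" (typed: for every
  `η > 0` there is `D₀` beyond which `(1 − η) e^{−3/2} β < L(1, χ)`)

is discharged here as `theorem pintz1977RealZeros_theorem2_holds : pintz1977RealZeros_theorem2`.
The statement file is untouched; the typed `Prop` is proved literally.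

## The printed proof and the road taken here

Source READ: Acta Arith. 33 (1977) pp. 89–97, rendered in the typing seat from the journal scan
`matwbn.icm.edu.pl/ksiazki/aa/aa33/aa3318.pdf` (6 two-page images `page01–06.png`: Theorem 2 on
p. 89, Lemmas 1–3 pp. 91–94, proof of Theorem 2 pp. 95–96 (4.4)).

PRINT. With `F(s) = ζ(s)L(s, χ) = Σ f(m) m^{−s}` (`f = 1 ∗ χ ≥ 0`, `f(1) = 1`) and the trivial bound
`A = D` for the character sums, Lemma 2 (partial summation and ANALYTIC CONTINUATION of `F` to
`σ > 2/3`) gives `Σ_{m ≤ x} f(m) m^{−s} = F(s) + (a/(1−s)) x^{1−s} + O(|s| (A/x)^{1/2} x^{1−σ})`,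
`a = L(1, χ)`; at `x = D^{3/2}`, `s = 1 − β` the error is `o(1)`, and since `L(1 − β) > 0` forces
`F(1 − β) < 0` (p. 96, (4.4)):
`1 + o(1) ≤ (1 + o(1)) Σ_{m ≤ x} f(m) m^{β−1} = F(1−β) + (a/β) x^β < (a/β) D^{3β/2} ≤ e^{3/2} L(1,χ)/β`.

HERE (declared deviation — the tree has no continuation of `ζ·L` below `σ = 1`, but it has the
complete ELEMENTARY Riesz-mean kit of `ExceptionalZeroLOneWidthProofs.lean`, there run at the
length `x = D`; this file re-runs it at a GENERAL natural length `x = N`). With `u = β`,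
`σ₀ = 1 − u`, `λ = 1 ∗ χ` and `S = Σ_{n ≤ N} λ(n) n^{−σ₀}(1 − n/N)` (`= FI2018.smoothSum χ σ₀ N`):

1. `S ≥ λ(1)(1 − 1/N) = 1 − 1/N` (`λ ≥ 0`).
2. Dirichlet's hyperbola rearrangement and the Riesz-mean evaluation
   `G(y) = Σ_{m ≤ y} m^{−σ₀}(1 − m/y) = y^u/(u(1+u)) + C_N + O((A(3+Λ)+2)/(u y))` under `y^u ≤ A`,
   `u log y ≤ Λ` (`FI2018.riesz_powerSum_estimate_general`, the general-length form of
   `FI2018.riesz_powerSum_estimate`) give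
   `S = (N^u/(u(1+u))) Σ_{d ≤ N} χ(d)/d + C_N Σ_{d ≤ N} χ(d) d^{−σ₀} + E`,
   `C_N = Σ_{m ≤ N} m^{−σ₀} − N^u/u ∈ [−1/u, 1 − 1/u]` — in particular `C_N < 0`, which plays the
   part of print's `F(1 − β) < 0` (`C_N → ζ(σ₀)` as `N → ∞`).
3. `Σ_{d ≤ N} χ(d) d^{−σ₀} ≥ Re L(σ₀, χ) − 2D (N+1)^{−σ₀}` and `Re L(σ₀, χ) > 0` (no zero on
   `[σ₀, 1]`; the tree's `DirichletAbel.LFunction_ofReal_re_pos_of_forall_ne_zero`), so the middle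
   term is `≤ (1/u) · 2D (N+1)^{−σ₀}`; `Σ_{d ≤ N} χ(d)/d ≤ Re L(1, χ) + 2D/N`; the error `E` is
   bounded with the TRIVIAL partial-sum bound `|Σ_{n ≤ x} χ(n)| ≤ D` (print's case "without the
   Pólya–Vinogradov inequality" — the theorem is about ALL non-principal real characters).
4. At `N = ⌊10⁶ D/u²⌋ + 1` (so `N^u ≤ 3` once `u ≤ 1/log D ≤ 10^{−4}`) this yields
   `Re L(1, χ) ≥ 0.29 u > e^{−3/2} u` for every `D ≥ D₀ = ⌈exp 10⁴⌉` — an ABSOLUTE threshold and a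
   constant BETTER than print's `e^{−3/2} ≈ 0.223` (stated on its own as
   `Pintz1977RealZeros.re_LFunction_one_ge_of_forall_ne_zero`); the typed `(1 − η)`-form follows
   for every `η > 0`.

Everything in this file is PROVED (theorems only; no definition, no named fact). WHAT THIS IS NOT:
no claim that any real zero exists or does not exist; nothing here bears on parity or on
Landau–Siegel zeros beyond Hecke's classical implication. «The programme SEARCHES and TYPES; no
claim about Landau–Siegel zeros, Theorems 1–2 of arXiv:2211.02515 or a repaired Margin232 until a
kernel theorem says so.»

## References

* [Pintz1977ElementaryVIII] J. Pintz, Acta Arith. 33 (1977) 89–98: Theorem 2 p. 89; Lemmas 1–2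
  pp. 91–94; proof of Theorem 2 pp. 95–96 (4.4).
* [FriedlanderIwaniec2018Note] J. B. Friedlander, H. Iwaniec, Expo. Math. 36 (2018) 343–350, §2
  (the Riesz mean `S(x)`; tree `ExceptionalZeroLOneWidthProofs.lean`).
* [MontgomeryVaughan2007] H. L. Montgomery, R. C. Vaughan, *Multiplicative Number Theory I*,
  CUP 2007: §1.3 Thm. 1.3 (Abel summation), §2.1 (hyperbola method), §4.3 (4.23).
-/

noncomputable section

open Finset Real
open Literature.NumberTheory.LFunctions.DirichletAbel
open Literature.NumberTheory.LFunctions.SiegelZero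

namespace Literature.NumberTheory.LFunctions

/-! ## Part A. The general-length Riesz-mean kit (namespace `FI2018`, re-usable)

Sections §1–§5 extend the kit of `ExceptionalZeroLOneWidthProofs.lean` (there run at the length
`x = q`, the modulus, under the standing size conditions of Friedlander–Iwaniec's Proposition 2.1) to
an ARBITRARY natural length `N`, with the size conditions replaced by two parameters `A ≥ N^{1−β}`
and `Λ ≥ (1−β) log N` and the partial-sum bound `B` of `χ` kept as a parameter. Nothing in Part A
is specific to Pintz's Theorem 2; it is the common workhorse of the elementary method (Pintz I–VIII). -/

namespace FI2018

/-! ### §1. Power sums (the elementary inputs, as in `ExceptionalZeroLOneWidthProofs.lean`) -/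

/-- The sequence `c_N = Σ_{n ≤ N} n^{−β} − N^{1−β}/(1−β)` is non-increasing with steps `≤ N^{−β}`:
for `1 ≤ N ≤ M`, `0 ≤ c_N − c_M ≤ N^{−β}` (`0 ≤ β < 1`). [folklore] -/
private theorem powerSum_sub_main_antitone {β : ℝ} (hβ0 : 0 ≤ β) (hβ1 : β < 1) {N M : ℕ}
    (hN : 1 ≤ N) (h : N ≤ M) :
    0 ≤ (∑ n ∈ Icc 1 N, (n : ℝ) ^ (-β) - (N : ℝ) ^ (1 - β) / (1 - β)) -
        (∑ n ∈ Icc 1 M, (n : ℝ) ^ (-β) - (M : ℝ) ^ (1 - β) / (1 - β)) ∧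
      (∑ n ∈ Icc 1 N, (n : ℝ) ^ (-β) - (N : ℝ) ^ (1 - β) / (1 - β)) -
        (∑ n ∈ Icc 1 M, (n : ℝ) ^ (-β) - (M : ℝ) ^ (1 - β) / (1 - β)) ≤ (N : ℝ) ^ (-β) := by
  have hI : ∀ K : ℕ, Finset.Icc 1 K = Finset.Ioc 0 K := fun K => by
    ext n; simp only [Finset.mem_Icc, Finset.mem_Ioc]; omega
  have hsplit : ∑ n ∈ Icc 1 M, (n : ℝ) ^ (-β) =
      ∑ n ∈ Icc 1 N, (n : ℝ) ^ (-β) + ∑ n ∈ Ioc N M, (n : ℝ) ^ (-β) := by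
    rw [hI, hI, ← Finset.sum_Ioc_consecutive _ (Nat.zero_le N) h]
  have hb := SiegelZero.sum_Ioc_rpow_bounds hβ0 hβ1 hN h
  have e : ((M : ℝ) ^ (1 - β) - (N : ℝ) ^ (1 - β)) / (1 - β) =
      (M : ℝ) ^ (1 - β) / (1 - β) - (N : ℝ) ^ (1 - β) / (1 - β) := by ring
  rw [e] at hb
  constructor
  · rw [hsplit]; linarith [hb.2]
  · rw [hsplit]; linarith [hb.1]

/-- Discrete Abel summation for `Σ m · a(m)`: with `P(k) = Σ_{m ≤ k} a(m)`,
`Σ_{m ≤ n+1} m a(m) = (n+1) P(n+1) − Σ_{k ≤ n} P(k)`. [folklore] -/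
private theorem sum_natCast_mul_eq_abel (a : ℕ → ℝ) (n : ℕ) :
    ∑ m ∈ Icc 1 (n + 1), (m : ℝ) * a m =
      ((n : ℝ) + 1) * ∑ m ∈ Icc 1 (n + 1), a m - ∑ i ∈ range n, ∑ m ∈ Icc 1 (i + 1), a m := by
  induction n with
  | zero => simp
  | succ n ih =>
    rw [Finset.sum_Icc_succ_top (show 1 ≤ n + 1 + 1 by omega), ih,
      Finset.sum_Icc_succ_top (show 1 ≤ n + 1 + 1 by omega), Finset.sum_range_succ]
    push_cast
    ring

/-- `Σ_{k ≤ n} k^{u}` against `(n+1)^{1+u}/(1+u)` (`0 < u ≤ 1`):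
`(n+1)^{1+u}/(1+u) − (n+1)^u ≤ Σ_{i<n} (i+1)^u ≤ (n+1)^{1+u}/(1+u)`. [folklore] -/
private theorem sum_range_succ_rpow_bounds {u : ℝ} (hu0 : 0 < u) (hu1 : u ≤ 1) (n : ℕ) :
    ((n : ℝ) + 1) ^ (1 + u) / (1 + u) - ((n : ℝ) + 1) ^ u ≤ ∑ i ∈ range n, ((i : ℝ) + 1) ^ u ∧
      ∑ i ∈ range n, ((i : ℝ) + 1) ^ u ≤ ((n : ℝ) + 1) ^ (1 + u) / (1 + u) := by
  have h1u : 0 < 1 + u := by linarith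
  have hmono' : ∀ a b : ℝ, 0 ≤ a → MonotoneOn (fun x : ℝ => x ^ u) (Set.Icc a b) := by
    intro a b ha x hx y _ hxy
    exact Real.rpow_le_rpow (ha.trans hx.1) hxy hu0.le
  constructor
  · have hint := MonotoneOn.integral_le_sum (x₀ := 0) (a := n) (f := fun x : ℝ => x ^ u)
      (hmono' 0 _ le_rfl)
    simp only [zero_add] at hint
    rw [integral_rpow (Or.inl (by linarith))] at hint
    rw [Real.zero_rpow (show u + 1 ≠ 0 by linarith)] at hint
    have hsum : ∑ i ∈ range n, ((↑(i + 1) : ℝ)) ^ u = ∑ i ∈ range n, ((i : ℝ) + 1) ^ u := by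
      refine Finset.sum_congr rfl fun i _ => ?_
      push_cast; ring_nf
    rw [hsum] at hint
    have hsec : ((n : ℝ) + 1) ^ (1 + u) - (n : ℝ) ^ (1 + u) ≤ (1 + u) * ((n : ℝ) + 1) ^ u := by
      rcases Nat.eq_zero_or_pos n with hn | hn
      · subst hn
        simp only [Nat.cast_zero, zero_add, Real.one_rpow, Real.zero_rpow h1u.ne']
        linarith
      · have hn0 : (0 : ℝ) < n := by exact_mod_cast hn
        have hx : (n : ℝ) ≤ n + 1 := by linarith
        have ex : ((n : ℝ) + 1) ^ (1 + u) = ((n : ℝ) + 1) * ((n : ℝ) + 1) ^ u := by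
          rw [Real.rpow_add (by linarith), Real.rpow_one]
        have ey : (n : ℝ) ^ (1 + u) = (n : ℝ) * (n : ℝ) ^ u := by
          rw [Real.rpow_add hn0, Real.rpow_one]
        have hs := SiegelZero.rpow_sub_rpow_le_mul (κ := u) hn0 hx hu0.le hu1
        have hyu : (n : ℝ) * (n : ℝ) ^ (u - 1) = (n : ℝ) ^ u := by
          rw [Real.rpow_sub hn0, Real.rpow_one]
          field_simp
        have hle : (n : ℝ) ^ u ≤ ((n : ℝ) + 1) ^ u := Real.rpow_le_rpow hn0.le hx hu0.le
        have hkey : (n : ℝ) * (((n : ℝ) + 1) ^ u - (n : ℝ) ^ u) ≤ u * (n : ℝ) ^ u := by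
          have := mul_le_mul_of_nonneg_left hs hn0.le
          calc (n : ℝ) * (((n : ℝ) + 1) ^ u - (n : ℝ) ^ u)
              ≤ (n : ℝ) * (u * (n : ℝ) ^ (u - 1) * ((n : ℝ) + 1 - n)) := this
            _ = u * ((n : ℝ) * (n : ℝ) ^ (u - 1)) := by ring
            _ = u * (n : ℝ) ^ u := by rw [hyu]
        rw [ex, ey]
        nlinarith [hle, hkey, hu0]
    have hdiv : ((n : ℝ) + 1) ^ (1 + u) / (1 + u) - ((n : ℝ) + 1) ^ u ≤
        (n : ℝ) ^ (1 + u) / (1 + u) := by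
      rw [sub_le_iff_le_add, div_le_iff₀ h1u]
      have : ((n : ℝ) ^ (1 + u) / (1 + u) + ((n : ℝ) + 1) ^ u) * (1 + u) =
          (n : ℝ) ^ (1 + u) + (1 + u) * ((n : ℝ) + 1) ^ u := by
        field_simp
      rw [this]
      linarith
    have e2 : (n : ℝ) ^ (u + 1) / (u + 1) = (n : ℝ) ^ (1 + u) / (1 + u) := by
      rw [add_comm u 1]
    rw [sub_zero, e2] at hint
    exact hdiv.trans hint
  · have hint := MonotoneOn.sum_le_integral (x₀ := 1) (a := n) (f := fun x : ℝ => x ^ u)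
      (hmono' 1 _ zero_le_one)
    rw [integral_rpow (Or.inl (by linarith))] at hint
    simp only [Real.one_rpow] at hint
    have hsum : ∑ i ∈ range n, ((1 : ℝ) + (i : ℝ)) ^ u = ∑ i ∈ range n, ((i : ℝ) + 1) ^ u := by
      refine Finset.sum_congr rfl fun i _ => ?_
      rw [add_comm]
    rw [hsum] at hint
    refine hint.trans ?_
    rw [add_comm (1 : ℝ) (n : ℝ), add_comm u 1]
    apply div_le_div_of_nonneg_right _ h1u.le
    linarith

/-- `|x₁ + x₂ − x₃ + x₄ − x₅ + x₆| ≤ Σ |xᵢ|`. [folklore] -/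
private theorem abs_add_six_le (x₁ x₂ x₃ x₄ x₅ x₆ : ℝ) :
    |x₁ + x₂ - x₃ + x₄ - x₅ + x₆| ≤ |x₁| + |x₂| + |x₃| + |x₄| + |x₅| + |x₆| := by
  have h1 := abs_add_le (x₁ + x₂ - x₃ + x₄ - x₅) x₆
  have h2 := abs_sub (x₁ + x₂ - x₃ + x₄) x₅
  have h3 := abs_add_le (x₁ + x₂ - x₃) x₄
  have h4 := abs_sub (x₁ + x₂) x₃
  have h5 := abs_add_le x₁ x₂
  linarith

/-! ### §2. The Riesz mean `G(y) = Σ_{m ≤ y} m^{−β}(1 − m/y)` at a general length -/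

/-- **The Riesz mean against `y^{1−β}/((1−β)(2−β)) + C`, general length** (the tree's
`FI2018.riesz_powerSum_estimate` with its standing size conditions `y^{1−β} ≤ 7/5`,
`log y ≤ 1/(3(1−β))` replaced by parameters): for `2/3 ≤ β < 1`, `u = 1 − β`, an integer
`N = n+1 ≤ y < N+1`, `1 ≤ A`, `0 ≤ Λ`, `y^u ≤ A`, `u log y ≤ Λ`, and a constant `C` with
`|C| ≤ 1/u + 1` such that `0 ≤ Σ_{m≤k} m^{−β} − k^u/u − C ≤ k^{−β}` for `1 ≤ k ≤ N`:
`|G(y) − y^u/(u(1+u)) − C| ≤ (A(3+Λ)+2)/(u y)`. This is the elementary stand-in for Pintz's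
Lemma 2 (3.12) at `j = 1`. [cite: Pintz1977ElementaryVIII, §3 Lemma 2 (3.11)–(3.12) p. 93]
[cite: FriedlanderIwaniec2018Note, §2 (proof of Proposition 2.1)] -/
theorem riesz_powerSum_estimate_general {β : ℝ} (hβ : 2 / 3 ≤ β) (hβ1 : β < 1) (n : ℕ)
    {y A Λ : ℝ} (hNy : (n : ℝ) + 1 ≤ y) (hyN : y < (n : ℝ) + 2) (hA : 1 ≤ A)
    (hyu : y ^ (1 - β) ≤ A) (hlogy : (1 - β) * Real.log y ≤ Λ) {C : ℝ}
    (hC : |C| ≤ 1 / (1 - β) + 1)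
    (hP : ∀ k : ℕ, 1 ≤ k → k ≤ n + 1 →
      0 ≤ ∑ m ∈ Icc 1 k, (m : ℝ) ^ (-β) - (k : ℝ) ^ (1 - β) / (1 - β) - C ∧
        ∑ m ∈ Icc 1 k, (m : ℝ) ^ (-β) - (k : ℝ) ^ (1 - β) / (1 - β) - C ≤ (k : ℝ) ^ (-β)) :
    |∑ m ∈ Icc 1 (n + 1), (m : ℝ) ^ (-β) * (1 - (m : ℝ) / y) -
        y ^ (1 - β) / ((1 - β) * (2 - β)) - C| ≤ (A * (3 + Λ) + 2) / ((1 - β) * y) := by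
  -- notation
  set u : ℝ := 1 - β with hu_def
  have hu0 : 0 < u := by rw [hu_def]; linarith only [hβ1]
  have hu3 : u ≤ 1 / 3 := by rw [hu_def]; linarith only [hβ]
  have hu1 : u ≤ 1 := by linarith only [hu3]
  have h1u : 0 < 1 + u := by linarith only [hu0]
  set N : ℕ := n + 1 with hN_def
  have hN1 : 1 ≤ N := by omega
  have hNpos : (0 : ℝ) < N := by positivity
  have hNr : (N : ℝ) = n + 1 := by rw [hN_def]; push_cast; ring
  have hn0 : (0 : ℝ) ≤ n := Nat.cast_nonneg n
  have hy0 : 0 < y := by linarith only [hNy, hn0]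
  have hy1 : 1 ≤ y := by linarith only [hNy, hn0]
  have hNley : (N : ℝ) ≤ y := by rw [hNr]; exact hNy
  have hyN' : y - N < 1 := by rw [hNr]; linarith only [hyN]
  set P : ℕ → ℝ := fun k => ∑ m ∈ Icc 1 k, (m : ℝ) ^ (-β) with hP_def
  set a : ℝ := (N : ℝ) ^ u with ha_def
  set b : ℝ := y ^ u with hb_def
  have ha0 : 0 < a := Real.rpow_pos_of_pos hNpos u
  have hb0 : 0 < b := Real.rpow_pos_of_pos hy0 u
  have hab : a ≤ b := Real.rpow_le_rpow hNpos.le hNley hu0.le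
  have hbE : b ≤ A := hyu
  have haE : a ≤ A := hab.trans hbE
  have hA0 : 0 ≤ A := le_trans zero_le_one hA
  -- `N^{-β} = a / N`, `N^{1+u} = N a`, `y^{1+u} = y b`
  have hNβ : (N : ℝ) ^ (-β) = a / N := by
    rw [ha_def, hu_def, show -β = (1 - β) - 1 by ring, Real.rpow_sub hNpos, Real.rpow_one]
  have hN1u : (N : ℝ) ^ (1 + u) = N * a := by
    rw [Real.rpow_add hNpos, Real.rpow_one]
  -- (1) `G = P(N) − (1/y) Σ m · m^{-β}` and discrete Abel
  have hG : ∑ m ∈ Icc 1 N, (m : ℝ) ^ (-β) * (1 - (m : ℝ) / y) =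
      P N - (1 / y) * ∑ m ∈ Icc 1 N, (m : ℝ) * (m : ℝ) ^ (-β) := by
    rw [hP_def, Finset.mul_sum, ← Finset.sum_sub_distrib]
    refine Finset.sum_congr rfl fun m _ => ?_
    ring
  have hAbel : ∑ m ∈ Icc 1 N, (m : ℝ) * (m : ℝ) ^ (-β) = N * P N - ∑ i ∈ range n, P (i + 1) := by
    rw [hNr]
    exact sum_natCast_mul_eq_abel (fun m => (m : ℝ) ^ (-β)) n
  -- (2) `P(N) = a/u + C + θN`
  obtain ⟨hθN0, hθN1⟩ := hP N hN1 le_rfl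
  set θN : ℝ := P N - (N : ℝ) ^ (1 - β) / (1 - β) - C with hθN_def
  have hPN : P N = a / u + C + θN := by rw [hθN_def, ha_def, hu_def]; ring
  rw [hNβ] at hθN1
  -- (3) `Σ_{i<n} P(i+1) = (1/u) Σ (i+1)^u + n C + Θ`, `0 ≤ Θ ≤ P N`
  set Θ : ℝ := ∑ i ∈ range n, (P (i + 1) - ((i : ℝ) + 1) ^ u / u - C) with hΘ_def
  have hSumP : ∑ i ∈ range n, P (i + 1) =
      (1 / u) * ∑ i ∈ range n, ((i : ℝ) + 1) ^ u + n * C + Θ := by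
    rw [hΘ_def, Finset.mul_sum]
    have : ∀ i ∈ range n, P (i + 1) =
        1 / u * ((i : ℝ) + 1) ^ u + C + (P (i + 1) - ((i : ℝ) + 1) ^ u / u - C) := by
      intro i _; ring
    rw [Finset.sum_congr rfl this, Finset.sum_add_distrib, Finset.sum_add_distrib,
      Finset.sum_const, Finset.card_range]
    simp
  have hΘ0 : 0 ≤ Θ := by
    rw [hΘ_def]
    refine Finset.sum_nonneg fun i hi => ?_
    have hi' : i + 1 ≤ n + 1 := by have := Finset.mem_range.mp hi; omega
    have h := (hP (i + 1) (by omega) hi').1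
    show 0 ≤ ∑ m ∈ Icc 1 (i + 1), (m : ℝ) ^ (-β) - ((i : ℝ) + 1) ^ u / u - C
    push_cast at h
    exact h
  have hΘ1 : Θ ≤ P N := by
    have hle : Θ ≤ ∑ i ∈ range n, ((i : ℝ) + 1) ^ (-β) := by
      rw [hΘ_def]
      refine Finset.sum_le_sum fun i hi => ?_
      have hi' : i + 1 ≤ n + 1 := by have := Finset.mem_range.mp hi; omega
      have h := (hP (i + 1) (by omega) hi').2
      show ∑ m ∈ Icc 1 (i + 1), (m : ℝ) ^ (-β) - ((i : ℝ) + 1) ^ u / u - C ≤ ((i : ℝ) + 1) ^ (-β)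
      push_cast at h
      exact h
    refine hle.trans ?_
    have e : ∑ i ∈ range n, ((i : ℝ) + 1) ^ (-β) = ∑ m ∈ Icc 1 n, (m : ℝ) ^ (-β) := by
      have hI : Finset.Icc 1 n = Finset.Ioc 0 n := by
        ext m; simp only [Finset.mem_Icc, Finset.mem_Ioc]; omega
      rw [hI, DirichletAbel.sum_Ioc_eq_sum_range_succ]
      refine Finset.sum_congr rfl fun i _ => ?_
      push_cast; ring_nf
    rw [e, hP_def]
    exact Finset.sum_le_sum_of_subset_of_nonneg (Finset.Icc_subset_Icc_right (by omega))
      fun m _ _ => Real.rpow_nonneg (Nat.cast_nonneg m) _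
  have hPNle : P N ≤ 1 + a * Real.log N := by
    have := SiegelZero.sum_Icc_rpow_le_log (by linarith : (0 : ℝ) ≤ β) hβ1 hN1
    rw [hP_def, ha_def, hu_def]
    exact this
  have hlogN0 : 0 ≤ Real.log N := Real.log_nonneg (by exact_mod_cast hN1)
  have hlogN : Real.log N ≤ Λ / u := by
    rw [le_div_iff₀ hu0]
    have h1 : Real.log N ≤ Real.log y := Real.log_le_log hNpos hNley
    have h2 : Real.log N * u ≤ Real.log y * u := mul_le_mul_of_nonneg_right h1 hu0.le
    have h3 : u * Real.log y ≤ Λ := by rw [hu_def]; exact hlogy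
    linarith only [h2, h3]
  have haLog : a * Real.log N ≤ A * (Λ / u) :=
    mul_le_mul haE hlogN hlogN0 hA0
  -- (4) `Σ_{i<n} (i+1)^u = N^{1+u}/(1+u) − θ'`, `0 ≤ θ' ≤ a`
  obtain ⟨hS1, hS2⟩ := sum_range_succ_rpow_bounds hu0 hu1 n
  set θ' : ℝ := ((n : ℝ) + 1) ^ (1 + u) / (1 + u) - ∑ i ∈ range n, ((i : ℝ) + 1) ^ u with hθ'_def
  have hθ'0 : 0 ≤ θ' := by rw [hθ'_def]; linarith only [hS2]
  have hθ'1 : θ' ≤ a := by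
    rw [hθ'_def, ha_def, hNr]; linarith only [hS1]
  have hSumU : ∑ i ∈ range n, ((i : ℝ) + 1) ^ u = N * a / (1 + u) - θ' := by
    rw [hθ'_def, ← hNr, hN1u]; ring
  -- (5) the secant bounds in `y`
  have hfloor : ⌊y⌋₊ = N := by
    rw [hN_def]
    have h1 : ((n + 1 : ℕ) : ℝ) ≤ y := by push_cast; exact hNy
    have h2 : y < ((n + 1 : ℕ) : ℝ) + 1 := by push_cast; linarith only [hyN]
    exact Nat.floor_eq_iff hy0.le |>.mpr ⟨h1, h2⟩
  have hsec1 : 0 ≤ b - a ∧ b - a ≤ u * (a / N) := by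
    have h := SiegelZero.rpow_sub_floor_rpow_bounds (by linarith : (0 : ℝ) ≤ β) hβ1 hy1
    rw [hfloor, hNβ] at h
    rw [hb_def, ha_def, hu_def]
    exact h
  have hsec2 : 0 ≤ y * b - N * a ∧ y * b - N * a ≤ (1 + u) * b := by
    have e : y * b - N * a = (y - N) * b + N * (b - a) := by ring
    rw [e]
    constructor
    · exact add_nonneg (mul_nonneg (sub_nonneg.mpr hNley) hb0.le)
        (mul_nonneg hNpos.le (sub_nonneg.mpr hab))
    · have h1 : (y - N) * b ≤ 1 * b := mul_le_mul_of_nonneg_right hyN'.le hb0.le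
      have h2 : (N : ℝ) * (b - a) ≤ u * a := by
        have := mul_le_mul_of_nonneg_left hsec1.2 hNpos.le
        calc (N : ℝ) * (b - a) ≤ N * (u * (a / N)) := this
          _ = u * a := by field_simp
      have h3 : u * a ≤ u * b := mul_le_mul_of_nonneg_left hab hu0.le
      have e2 : (1 + u) * b = 1 * b + u * b := by ring
      rw [e2]
      linarith only [h1, h2, h3]
  -- (6) the identity `G − T = (a−b)/u + (yb − Na)/((1+u)y) − C/y + θN(1−N/y) − θ'/(uy) + Θ/y`
  have hβ2 : 2 - β = 1 + u := by rw [hu_def]; ring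
  have hGT : ∑ m ∈ Icc 1 N, (m : ℝ) ^ (-β) * (1 - (m : ℝ) / y) - y ^ (1 - β) / ((1 - β) * (2 - β)) - C
      = (a - b) / u + (y * b - N * a) / ((1 + u) * y) - C / y + θN * (1 - N / y)
        - θ' / (u * y) + Θ / y := by
    rw [hG, hAbel, hSumP, hSumU, hPN, hβ2, ← hu_def, ← hb_def]
    have hn : (n : ℝ) = N - 1 := by rw [hNr]; ring
    rw [hn]
    field_simp
    ring
  -- (7) bound each term
  rw [hGT]
  have hy2N : 1 / (N : ℝ) ≤ 2 / y := by
    rw [div_le_div_iff₀ hNpos hy0]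
    have : y < (N : ℝ) + 1 := by linarith only [hyN']
    have hN1r : (1 : ℝ) ≤ N := by exact_mod_cast hN1
    linarith only [this, hN1r]
  have t1 : |(a - b) / u| ≤ 2 * A / y := by
    rw [abs_div, abs_of_pos hu0, abs_sub_comm, abs_of_nonneg hsec1.1, div_le_iff₀ hu0]
    calc b - a ≤ u * (a / N) := hsec1.2
      _ = u * (a * (1 / N)) := by ring
      _ ≤ u * (A * (2 / y)) := by gcongr
      _ = 2 * A / y * u := by ring
  have t2 : |(y * b - N * a) / ((1 + u) * y)| ≤ A / y := by
    rw [abs_div, abs_of_nonneg hsec2.1, abs_of_pos (by positivity), div_le_div_iff₀ (by positivity) hy0]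
    calc (y * b - N * a) * y ≤ (1 + u) * b * y := by
          exact mul_le_mul_of_nonneg_right hsec2.2 hy0.le
      _ ≤ (1 + u) * A * y := by gcongr
      _ = A * ((1 + u) * y) := by ring
  have t3 : |C / y| ≤ (1 / u + 1) / y := by
    rw [abs_div, abs_of_pos hy0]
    exact div_le_div_of_nonneg_right (by rw [hu_def]; exact hC) hy0.le
  have t4 : |θN * (1 - N / y)| ≤ 2 * A / y := by
    have h01 : 0 ≤ 1 - (N : ℝ) / y := by
      rw [sub_nonneg, div_le_one hy0]; exact hNley
    have h11 : 1 - (N : ℝ) / y ≤ 1 := by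
      have : 0 ≤ (N : ℝ) / y := by positivity
      linarith only [this]
    rw [abs_mul, abs_of_nonneg hθN0, abs_of_nonneg h01]
    calc θN * (1 - N / y) ≤ (a / N) * 1 := by gcongr
      _ = a * (1 / N) := by ring
      _ ≤ A * (2 / y) := by gcongr
      _ = 2 * A / y := by ring
  have t5 : |θ' / (u * y)| ≤ A / (u * y) := by
    rw [abs_div, abs_of_nonneg hθ'0, abs_of_pos (by positivity)]
    gcongr
    exact hθ'1.trans haE
  have t6 : |Θ / y| ≤ (1 + A * (Λ / u)) / y := by
    rw [abs_div, abs_of_nonneg hΘ0, abs_of_pos hy0]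
    gcongr
    calc Θ ≤ P N := hΘ1
      _ ≤ 1 + a * Real.log N := hPNle
      _ ≤ 1 + A * (Λ / u) := by linarith only [haLog]
  -- (8) add up
  have hsum := abs_add_six_le ((a - b) / u) ((y * b - N * a) / ((1 + u) * y)) (C / y)
      (θN * (1 - N / y)) (θ' / (u * y)) (Θ / y)
  have htot : |(a - b) / u + (y * b - N * a) / ((1 + u) * y) - C / y + θN * (1 - N / y)
      - θ' / (u * y) + Θ / y| ≤
      2 * A / y + A / y + (1 / u + 1) / y + 2 * A / y + A / (u * y)
        + (1 + A * (Λ / u)) / y := by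
    linarith only [hsum, t1, t2, t3, t4, t5, t6]
  refine htot.trans ?_
  have huy : 0 < u * y := by positivity
  have hkey : 2 * A / y + A / y + (1 / u + 1) / y + 2 * A / y + A / (u * y)
      + (1 + A * (Λ / u)) / y = (5 * A * u + 2 * u + 1 + A + A * Λ) / (u * y) := by
    field_simp
    ring
  rw [hkey]
  apply div_le_div_of_nonneg_right _ huy.le
  nlinarith only [hu3, hA, hu0]

/-- **Term-by-term estimate at length `N`**: for `1 ≤ d ≤ N` (`N^{1−β} ≤ A`,
`(1−β) log N ≤ Λ`), with `C_N = Σ_{m ≤ N} m^{−β} − N^{1−β}/(1−β)`: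
`|G_d − (N/d)^{1−β}/((1−β)(2−β)) − C_N| ≤ (A(3+Λ)+2) d/((1−β) N)`,
`G_d = Σ_{m ≤ N/d} m^{−β}(1 − d m/N)` (`riesz_powerSum_estimate_general` at `y = N/d`).
[cite: Pintz1977ElementaryVIII, §3 Lemma 2 (3.12) p. 93]
[cite: FriedlanderIwaniec2018Note, §2 (proof of Proposition 2.1)] -/
theorem riesz_term_estimate_general {N : ℕ} {β : ℝ} (hβ : 2 / 3 ≤ β) (hβ1 : β < 1)
    {A Λ : ℝ} (hA : 1 ≤ A) (hNu : (N : ℝ) ^ (1 - β) ≤ A)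
    (hlogN : (1 - β) * Real.log N ≤ Λ) {d : ℕ} (hd : 1 ≤ d) (hdN : d ≤ N) :
    |∑ m ∈ Icc 1 (N / d), (m : ℝ) ^ (-β) * (1 - (d : ℝ) * m / N)
        - ((N : ℝ) / d) ^ (1 - β) / ((1 - β) * (2 - β))
        - (∑ m ∈ Icc 1 N, (m : ℝ) ^ (-β) - (N : ℝ) ^ (1 - β) / (1 - β))|
      ≤ (A * (3 + Λ) + 2) * d / ((1 - β) * N) := by
  have hβ0 : (0 : ℝ) ≤ β := by linarith
  have hu0 : 0 < 1 - β := by linarith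
  have hN1 : 1 ≤ N := hd.trans hdN
  have hNpos : (0 : ℝ) < N := by exact_mod_cast hN1
  have hdpos : (0 : ℝ) < d := by exact_mod_cast hd
  set y : ℝ := (N : ℝ) / d with hy_def
  have hy0 : 0 < y := div_pos hNpos hdpos
  have hyN : y ≤ N := by
    rw [hy_def, div_le_iff₀ hdpos]
    have : (1 : ℝ) ≤ d := by exact_mod_cast hd
    nlinarith
  -- `M = N / d = ⌊y⌋ ≥ 1`
  set M : ℕ := N / d with hM_def
  have hM1 : 1 ≤ M := by
    rw [hM_def]
    exact (Nat.le_div_iff_mul_le hd).mpr (by simpa using hdN)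
  have hfloor : ⌊y⌋₊ = M := by rw [hy_def, hM_def]; exact Nat.floor_div_eq_div N d
  obtain ⟨n, hn⟩ : ∃ n : ℕ, M = n + 1 := ⟨M - 1, by omega⟩
  have hNy : (n : ℝ) + 1 ≤ y := by
    have : (M : ℝ) ≤ y := by rw [← hfloor]; exact Nat.floor_le hy0.le
    rw [hn] at this; push_cast at this; exact this
  have hyN' : y < (n : ℝ) + 2 := by
    have : y < (⌊y⌋₊ : ℝ) + 1 := Nat.lt_floor_add_one y
    rw [hfloor, hn] at this; push_cast at this; linarith
  have hyu : y ^ (1 - β) ≤ A := (Real.rpow_le_rpow hy0.le hyN hu0.le).trans hNu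
  have hlogy : (1 - β) * Real.log y ≤ Λ := by
    have h1 : Real.log y ≤ Real.log N := Real.log_le_log hy0 hyN
    have h2 : (1 - β) * Real.log y ≤ (1 - β) * Real.log N :=
      mul_le_mul_of_nonneg_left h1 hu0.le
    exact h2.trans hlogN
  have hC : |∑ m ∈ Icc 1 N, (m : ℝ) ^ (-β) - (N : ℝ) ^ (1 - β) / (1 - β)| ≤ 1 / (1 - β) + 1 :=
    (SiegelZero.abs_sum_Icc_rpow_sub_le hβ0 hβ1 hN1).trans (by linarith)
  have hP : ∀ k : ℕ, 1 ≤ k → k ≤ n + 1 →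
      0 ≤ ∑ m ∈ Icc 1 k, (m : ℝ) ^ (-β) - (k : ℝ) ^ (1 - β) / (1 - β) -
          (∑ m ∈ Icc 1 N, (m : ℝ) ^ (-β) - (N : ℝ) ^ (1 - β) / (1 - β)) ∧
        ∑ m ∈ Icc 1 k, (m : ℝ) ^ (-β) - (k : ℝ) ^ (1 - β) / (1 - β) -
          (∑ m ∈ Icc 1 N, (m : ℝ) ^ (-β) - (N : ℝ) ^ (1 - β) / (1 - β)) ≤ (k : ℝ) ^ (-β) := by
    intro k hk1 hkM
    have hkN : k ≤ N := by
      rw [← hn] at hkM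
      exact hkM.trans (hM_def ▸ Nat.div_le_self N d)
    exact powerSum_sub_main_antitone hβ0 hβ1 hk1 hkN
  have h := riesz_powerSum_estimate_general hβ hβ1 n hNy hyN' hA hyu hlogy hC hP
  have hsum : ∑ m ∈ Icc 1 (N / d), (m : ℝ) ^ (-β) * (1 - (d : ℝ) * m / N) =
      ∑ m ∈ Icc 1 (n + 1), (m : ℝ) ^ (-β) * (1 - (m : ℝ) / y) := by
    rw [← hM_def, hn]
    refine Finset.sum_congr rfl fun m _ => ?_
    rw [hy_def]
    field_simp
  rw [hsum]
  refine h.trans (le_of_eq ?_)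
  rw [hy_def]
  field_simp

/-! ### §3. The smoothed divisor sum `S = Σ_{n ≤ N} λ(n) n^{−β}(1 − n/N)` at length `N` -/

/-- **Hyperbola rearrangement at length `N`**: `S = Σ_{d ≤ N} χ(d) d^{−β} G_d`,
`G_d = Σ_{m ≤ N/d} m^{−β}(1 − d m/N)` (`λ = 1 ∗ χ`, `n = d m`; the tree's
`FI2018.smoothSum_natCast_eq` is the case `N = q`). [cite: MontgomeryVaughan2007, §2.1] -/
theorem smoothSum_natCast_eq_general {q : ℕ} (χ : DirichletCharacter ℂ q) (β : ℝ) (N : ℕ) :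
    FI2018.smoothSum χ β N = ∑ d ∈ Icc 1 N, (χ (d : ZMod q)).re * (d : ℝ) ^ (-β) *
      ∑ m ∈ Icc 1 (N / d), (m : ℝ) ^ (-β) * (1 - (d : ℝ) * m / N) := by
  unfold FI2018.smoothSum
  rw [Nat.floor_natCast]
  have h1 : ∀ n ∈ Icc 1 N, RealChar.charDivisorSum χ n * (1 - (n : ℝ) / N) * (n : ℝ) ^ (-β) =
      ∑ p ∈ n.divisorsAntidiagonal, (χ (p.1 : ZMod q)).re * (p.1 : ℝ) ^ (-β) *
        ((p.2 : ℝ) ^ (-β) * (1 - (p.1 : ℝ) * p.2 / N)) := by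
    intro n hn
    rw [RealChar.charDivisorSum_apply, Finset.sum_mul, Finset.sum_mul,
      Nat.sum_divisorsAntidiagonal (fun d e => (χ (d : ZMod q)).re * (d : ℝ) ^ (-β) *
        ((e : ℝ) ^ (-β) * (1 - (d : ℝ) * e / N)))]
    refine Finset.sum_congr rfl fun d hd => ?_
    have hdn : d ∣ n := Nat.dvd_of_mem_divisors hd
    have hd0 : d ≠ 0 := (Nat.pos_of_mem_divisors hd).ne'
    have hcast : (n : ℝ) = d * ((n / d : ℕ) : ℝ) := by
      rw [← Nat.cast_mul, Nat.mul_div_cancel' hdn]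
    rw [DirichletAbel.reChar_apply χ hd0, hcast, Real.mul_rpow (Nat.cast_nonneg d) (Nat.cast_nonneg _)]
    ring
  rw [Finset.sum_congr rfl h1,
    Literature.NumberTheory.Sieve.SquarefreeSums.sum_Icc_sum_divisorsAntidiagonal
      (fun d e => (χ (d : ZMod q)).re * (d : ℝ) ^ (-β) *
        ((e : ℝ) ^ (-β) * (1 - (d : ℝ) * e / N))) N]
  refine Finset.sum_congr rfl fun d _ => ?_
  rw [Finset.mul_sum]

/-- `d^{−β} (N/d)^{1−β} = N^{1−β}/d` (`d > 0`). [folklore] -/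
private theorem rpow_neg_mul_div_rpow {d N β : ℝ} (hd : 0 < d) (hN : 0 ≤ N) :
    d ^ (-β) * (N / d) ^ (1 - β) = N ^ (1 - β) / d := by
  rw [Real.div_rpow hN hd.le, show -β = (-1) + (1 - β) by ring, Real.rpow_add hd,
    Real.rpow_neg_one]
  have : d ^ (1 - β) ≠ 0 := (Real.rpow_pos_of_pos hd _).ne'
  field_simp

/-- **Decomposition of `S` at length `N`**: with `u = 1 − β`, `M₁ = N^u/(u(2−β))`,
`C_N = Σ_{m ≤ N} m^{−β} − N^u/u`, `R_d = G_d − (N/d)^u/(u(2−β)) − C_N`: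
`S = M₁ Σ_{d ≤ N} χ(d)/d + C_N Σ_{d ≤ N} χ(d) d^{−β} + Σ_{d ≤ N} χ(d) d^{−β} R_d`.
[cite: FriedlanderIwaniec2018Note, §2 (2.1)] -/
theorem smoothSum_decomposition_general {q : ℕ} (χ : DirichletCharacter ℂ q) {β : ℝ}
    (hβ1 : β < 1) (N : ℕ) :
    FI2018.smoothSum χ β N =
      (N : ℝ) ^ (1 - β) / ((1 - β) * (2 - β)) * ∑ d ∈ Icc 1 N, (χ (d : ZMod q)).re / d
      + (∑ m ∈ Icc 1 N, (m : ℝ) ^ (-β) - (N : ℝ) ^ (1 - β) / (1 - β)) *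
          ∑ d ∈ Icc 1 N, (χ (d : ZMod q)).re * (d : ℝ) ^ (-β)
      + ∑ d ∈ Icc 1 N, (χ (d : ZMod q)).re * (d : ℝ) ^ (-β) *
          (∑ m ∈ Icc 1 (N / d), (m : ℝ) ^ (-β) * (1 - (d : ℝ) * m / N)
            - ((N : ℝ) / d) ^ (1 - β) / ((1 - β) * (2 - β))
            - (∑ m ∈ Icc 1 N, (m : ℝ) ^ (-β) - (N : ℝ) ^ (1 - β) / (1 - β))) := by
  rw [smoothSum_natCast_eq_general, Finset.mul_sum, Finset.mul_sum, ← Finset.sum_add_distrib,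
    ← Finset.sum_add_distrib]
  refine Finset.sum_congr rfl fun d hd => ?_
  have hd1 : 1 ≤ d := (Finset.mem_Icc.mp hd).1
  have hdpos : (0 : ℝ) < d := by exact_mod_cast hd1
  have hN0 : (0 : ℝ) ≤ N := Nat.cast_nonneg N
  have key : (d : ℝ) ^ (-β) * ((N : ℝ) / d) ^ (1 - β) = (N : ℝ) ^ (1 - β) / d :=
    rpow_neg_mul_div_rpow hdpos hN0
  have hu : (1 - β) * (2 - β) ≠ 0 := by
    apply mul_ne_zero <;> linarith
  linear_combination ((χ (d : ZMod q)).re / ((1 - β) * (2 - β))) * key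

/-- `S ≥ 1 − 1/N` for `N ≥ 1`: the term `n = 1` is `λ(1)(1 − 1/N) = 1 − 1/N` and all terms are
non-negative (`λ = 1 ∗ χ ≥ 0` for quadratic `χ`). This is print's "`f(1) = 1, f(m) ≥ 0`".
[cite: Pintz1977ElementaryVIII, §4 proof of Theorem 2, (4.4) p. 96] -/
theorem one_sub_inv_le_smoothSum {q : ℕ} [NeZero q] (χ : DirichletCharacter ℂ q) (hq : χ ^ 2 = 1)
    (β : ℝ) {N : ℕ} (hN : 1 ≤ N) :
    1 - 1 / (N : ℝ) ≤ FI2018.smoothSum χ β N := by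
  unfold FI2018.smoothSum
  rw [Nat.floor_natCast]
  have h1 : (1 : ℕ) ∈ Icc 1 N := Finset.mem_Icc.mpr ⟨le_rfl, hN⟩
  have hterm : RealChar.charDivisorSum χ 1 * (1 - ((1 : ℕ) : ℝ) / N) * ((1 : ℕ) : ℝ) ^ (-β) =
      1 - 1 / (N : ℝ) := by
    rw [RealChar.charDivisorSum_apply, Nat.divisors_one, Finset.sum_singleton,
      DirichletAbel.reChar_apply χ one_ne_zero]
    push_cast
    rw [map_one, Complex.one_re, Real.one_rpow]
    ring
  have hNpos : (0 : ℝ) < N := by exact_mod_cast hN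
  have hnonneg : ∀ n ∈ Icc 1 N,
      0 ≤ RealChar.charDivisorSum χ n * (1 - (n : ℝ) / N) * (n : ℝ) ^ (-β) := by
    intro n hn
    have hnN : n ≤ N := (Finset.mem_Icc.mp hn).2
    refine mul_nonneg (mul_nonneg (RealChar.charDivisorSum_nonneg χ hq n) ?_)
      (Real.rpow_nonneg (Nat.cast_nonneg n) _)
    rw [sub_nonneg, div_le_one hNpos]
    exact_mod_cast hnN
  have hle := Finset.single_le_sum hnonneg h1
  rw [hterm] at hle
  exact hle

/-! ### §4. The error sum `Σ_d χ(d) d^{−β} R_d`: long range trivially, short range by Abel -/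

/-- The inner Riesz sums `G_d = Σ_{m ≤ N/d} m^{−β}(1 − d m/N)` are non-negative. [folklore] -/
private theorem riesz_inner_nonneg {N : ℕ} (β : ℝ) (d : ℕ) :
    0 ≤ ∑ m ∈ Icc 1 (N / d), (m : ℝ) ^ (-β) * (1 - (d : ℝ) * m / N) := by
  refine Finset.sum_nonneg fun m hm => mul_nonneg (Real.rpow_nonneg (Nat.cast_nonneg m) _) ?_
  rcases Nat.eq_zero_or_pos d with hd | hd
  · subst hd; simp
  have hmN : d * m ≤ N := by
    have := (Finset.mem_Icc.mp hm).2
    rw [mul_comm]; exact (Nat.le_div_iff_mul_le hd).mp this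
  have hN : (0 : ℝ) < N := by
    have : 0 < N := lt_of_lt_of_le (Nat.mul_pos hd (Finset.mem_Icc.mp hm).1) hmN
    exact_mod_cast this
  rw [sub_nonneg, div_le_one hN]
  exact_mod_cast hmN

/-- `G_d ≤ Σ_{m ≤ N/d} m^{−β}`. [folklore] -/
private theorem riesz_inner_le_powerSum {N : ℕ} (β : ℝ) (d : ℕ) :
    ∑ m ∈ Icc 1 (N / d), (m : ℝ) ^ (-β) * (1 - (d : ℝ) * m / N) ≤
      ∑ m ∈ Icc 1 (N / d), (m : ℝ) ^ (-β) := by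
  refine Finset.sum_le_sum fun m _ => ?_
  have h0 : 0 ≤ (m : ℝ) ^ (-β) := Real.rpow_nonneg (Nat.cast_nonneg m) _
  have h1 : 1 - (d : ℝ) * m / N ≤ 1 := by
    have : 0 ≤ (d : ℝ) * m / N := by positivity
    linarith
  calc (m : ℝ) ^ (-β) * (1 - (d : ℝ) * m / N) ≤ (m : ℝ) ^ (-β) * 1 :=
        mul_le_mul_of_nonneg_left h1 h0
    _ = (m : ℝ) ^ (-β) := mul_one _

/-- `G_{d+1} ≤ G_d` for `d ≥ 1`. [folklore] -/
private theorem riesz_inner_antitone {N : ℕ} {β : ℝ} {d : ℕ} (hd : 1 ≤ d) :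
    ∑ m ∈ Icc 1 (N / (d + 1)), (m : ℝ) ^ (-β) * (1 - ((d + 1 : ℕ) : ℝ) * m / N) ≤
      ∑ m ∈ Icc 1 (N / d), (m : ℝ) ^ (-β) * (1 - (d : ℝ) * m / N) := by
  have hsub : Finset.Icc 1 (N / (d + 1)) ⊆ Finset.Icc 1 (N / d) :=
    Finset.Icc_subset_Icc_right (Nat.div_le_div_left (Nat.le_succ d) hd)
  calc ∑ m ∈ Icc 1 (N / (d + 1)), (m : ℝ) ^ (-β) * (1 - ((d + 1 : ℕ) : ℝ) * m / N)
      ≤ ∑ m ∈ Icc 1 (N / (d + 1)), (m : ℝ) ^ (-β) * (1 - (d : ℝ) * m / N) := by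
        refine Finset.sum_le_sum fun m _ => ?_
        refine mul_le_mul_of_nonneg_left ?_ (Real.rpow_nonneg (Nat.cast_nonneg m) _)
        have : (0 : ℝ) ≤ (m : ℝ) / N := by positivity
        push_cast
        have e : ((d : ℝ) + 1) * m / N = (d : ℝ) * m / N + (m : ℝ) / N := by ring
        rw [e]; linarith
    _ ≤ ∑ m ∈ Icc 1 (N / d), (m : ℝ) ^ (-β) * (1 - (d : ℝ) * m / N) := by
        refine Finset.sum_le_sum_of_subset_of_nonneg hsub fun m hm _ => ?_
        refine mul_nonneg (Real.rpow_nonneg (Nat.cast_nonneg m) _) ?_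
        have hmN : d * m ≤ N := by
          rw [mul_comm]; exact (Nat.le_div_iff_mul_le hd).mp (Finset.mem_Icc.mp hm).2
        have hN : (0 : ℝ) < N := by
          have : 0 < N := lt_of_lt_of_le (Nat.mul_pos hd (Finset.mem_Icc.mp hm).1) hmN
          exact_mod_cast this
        rw [sub_nonneg, div_le_one hN]
        exact_mod_cast hmN

/-- **Long range** `d ≤ N₀`: `|Σ_{d ≤ N₀} χ(d) d^{−β} R_d| ≤ (A(3+Λ)+2) A N₀/((1−β) N)`
(`|R_d| ≤ (A(3+Λ)+2) d/((1−β)N)` and `d^{−β} d = d^{1−β} ≤ N^{1−β} ≤ A`).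
[cite: FriedlanderIwaniec2018Note, §2 (proof of Proposition 2.1)] -/
theorem abs_longRange_le_general {q : ℕ} (χ : DirichletCharacter ℂ q) {β : ℝ}
    (hβ : 2 / 3 ≤ β) (hβ1 : β < 1) {A Λ : ℝ} (hA : 1 ≤ A) (hΛ : 0 ≤ Λ) {N : ℕ}
    (hNu : (N : ℝ) ^ (1 - β) ≤ A) (hlogN : (1 - β) * Real.log N ≤ Λ) {N₀ : ℕ} (hN₀ : N₀ ≤ N) :
    |∑ d ∈ Icc 1 N₀, (χ (d : ZMod q)).re * (d : ℝ) ^ (-β) *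
        (∑ m ∈ Icc 1 (N / d), (m : ℝ) ^ (-β) * (1 - (d : ℝ) * m / N)
          - ((N : ℝ) / d) ^ (1 - β) / ((1 - β) * (2 - β))
          - (∑ m ∈ Icc 1 N, (m : ℝ) ^ (-β) - (N : ℝ) ^ (1 - β) / (1 - β)))|
      ≤ (A * (3 + Λ) + 2) * A * N₀ / ((1 - β) * N) := by
  have hu0 : 0 < 1 - β := by linarith
  have hA0 : 0 ≤ A := le_trans zero_le_one hA
  have hc0 : 0 ≤ A * (3 + Λ) + 2 := by positivity
  refine (Finset.abs_sum_le_sum_abs _ _).trans ?_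
  have hterm : ∀ d ∈ Icc 1 N₀, |(χ (d : ZMod q)).re * (d : ℝ) ^ (-β) *
      (∑ m ∈ Icc 1 (N / d), (m : ℝ) ^ (-β) * (1 - (d : ℝ) * m / N)
        - ((N : ℝ) / d) ^ (1 - β) / ((1 - β) * (2 - β))
        - (∑ m ∈ Icc 1 N, (m : ℝ) ^ (-β) - (N : ℝ) ^ (1 - β) / (1 - β)))|
      ≤ (A * (3 + Λ) + 2) * A / ((1 - β) * N) := by
    intro d hd
    have hd1 : 1 ≤ d := (Finset.mem_Icc.mp hd).1
    have hdN : d ≤ N := (Finset.mem_Icc.mp hd).2.trans hN₀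
    have hdpos : (0 : ℝ) < d := by exact_mod_cast hd1
    have hNpos : (0 : ℝ) < N := by exact_mod_cast hd1.trans hdN
    have hR := riesz_term_estimate_general hβ hβ1 hA hNu hlogN hd1 hdN
    rw [abs_mul, abs_mul]
    have ha : |(χ (d : ZMod q)).re| ≤ 1 := (Complex.abs_re_le_norm _).trans (χ.norm_le_one _)
    have hdb : |(d : ℝ) ^ (-β)| = (d : ℝ) ^ (-β) := abs_of_nonneg (Real.rpow_nonneg hdpos.le _)
    rw [hdb]
    have hdu : (d : ℝ) ^ (-β) * d = (d : ℝ) ^ (1 - β) := by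
      rw [show (1 - β) = -β + 1 by ring, Real.rpow_add hdpos, Real.rpow_one]
    have hdu' : (d : ℝ) ^ (1 - β) ≤ A :=
      (Real.rpow_le_rpow hdpos.le (by exact_mod_cast hdN) hu0.le).trans hNu
    calc |(χ (d : ZMod q)).re| * (d : ℝ) ^ (-β) * |_|
        ≤ 1 * (d : ℝ) ^ (-β) * ((A * (3 + Λ) + 2) * d / ((1 - β) * N)) := by
          gcongr
      _ = (A * (3 + Λ) + 2) * ((d : ℝ) ^ (-β) * d) / ((1 - β) * N) := by ring
      _ ≤ (A * (3 + Λ) + 2) * A / ((1 - β) * N) := by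
          rw [hdu]; gcongr
  calc ∑ d ∈ Icc 1 N₀, |(χ (d : ZMod q)).re * (d : ℝ) ^ (-β) *
        (∑ m ∈ Icc 1 (N / d), (m : ℝ) ^ (-β) * (1 - (d : ℝ) * m / N)
          - ((N : ℝ) / d) ^ (1 - β) / ((1 - β) * (2 - β))
          - (∑ m ∈ Icc 1 N, (m : ℝ) ^ (-β) - (N : ℝ) ^ (1 - β) / (1 - β)))|
      ≤ ∑ d ∈ Icc 1 N₀, (A * (3 + Λ) + 2) * A / ((1 - β) * N) := Finset.sum_le_sum hterm
    _ = (A * (3 + Λ) + 2) * A * N₀ / ((1 - β) * N) := by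
        rw [Finset.sum_const, Nat.card_Icc, Nat.add_sub_cancel, nsmul_eq_mul]
        ring

/-- `(M+1)^{−β} ≤ A/(M+1)` when `M + 1 ≤ N` and `N^{1−β} ≤ A` (`β < 1`). [folklore] -/
private theorem rpow_neg_le_div {N M : ℕ} {β A : ℝ} (hβ1 : β < 1) (hNu : (N : ℝ) ^ (1 - β) ≤ A)
    (hM : M + 1 ≤ N) :
    ((M : ℝ) + 1) ^ (-β) ≤ A / ((M : ℝ) + 1) := by
  have hM0 : (0 : ℝ) < (M : ℝ) + 1 := by positivity
  have hMN : (M : ℝ) + 1 ≤ N := by exact_mod_cast hM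
  have e : ((M : ℝ) + 1) ^ (-β) = ((M : ℝ) + 1) ^ (1 - β) / ((M : ℝ) + 1) := by
    rw [show (1 - β) = -β + 1 by ring, Real.rpow_add hM0, Real.rpow_one]
    field_simp
  rw [e]
  exact div_le_div_of_nonneg_right
    ((Real.rpow_le_rpow hM0.le hMN (by linarith)).trans hNu) hM0.le

/-- **Short range** `N₀ < d ≤ N`: three finite Abel summations against the non-increasing weights
`d^{−β} G_d`, `1/d`, `d^{−β}` give `|Σ_{N₀<d≤N} χ(d) d^{−β} R_d| ≤ 2BA(AΛ+3)/((1−β)(N₀+1))`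
(`B` a bound for the partial sums of `χ`; `N^{1−β} ≤ A`, `(1−β) log N ≤ Λ`).
[cite: MontgomeryVaughan2007, §1.3 Thm. 1.3] -/
theorem abs_shortRange_le_general {q : ℕ} [NeZero q] (χ : DirichletCharacter ℂ q) (hq : χ ^ 2 = 1)
    {B : ℝ} (hB : ∀ n, ‖partialSum χ n‖ ≤ B) {β : ℝ} (hβ : 2 / 3 ≤ β) (hβ1 : β < 1)
    {A Λ : ℝ} (hA : 1 ≤ A) {N : ℕ} (hNu : (N : ℝ) ^ (1 - β) ≤ A)
    (hlogN : (1 - β) * Real.log N ≤ Λ) {N₀ : ℕ} (hN₀ : N₀ < N) :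
    |∑ d ∈ Ioc N₀ N, (χ (d : ZMod q)).re * (d : ℝ) ^ (-β) *
        (∑ m ∈ Icc 1 (N / d), (m : ℝ) ^ (-β) * (1 - (d : ℝ) * m / N)
          - ((N : ℝ) / d) ^ (1 - β) / ((1 - β) * (2 - β))
          - (∑ m ∈ Icc 1 N, (m : ℝ) ^ (-β) - (N : ℝ) ^ (1 - β) / (1 - β)))|
      ≤ 2 * B * A * (A * Λ + 3) / ((1 - β) * ((N₀ : ℝ) + 1)) := by
  have hβ0 : (0 : ℝ) ≤ β := by linarith
  set u : ℝ := 1 - β with hu_def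
  have hu0 : 0 < u := by rw [hu_def]; linarith only [hβ1]
  have hu3 : u ≤ 1 / 3 := by rw [hu_def]; linarith only [hβ]
  have hu1 : u ≤ 1 := by linarith only [hu3]
  have hB0 : 0 ≤ B := (norm_nonneg _).trans (hB 0)
  have hA0 : 0 ≤ A := le_trans zero_le_one hA
  have hN1 : 1 ≤ N := by omega
  have hNpos : (0 : ℝ) < N := by exact_mod_cast hN1
  have hN₀1 : N₀ + 1 ≤ N := hN₀
  have hN₀pos : (0 : ℝ) < (N₀ : ℝ) + 1 := by positivity
  have hlogN' : Real.log N ≤ Λ / u := by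
    rw [le_div_iff₀ hu0, mul_comm]; rw [hu_def]; exact hlogN
  -- abbreviations (as functions of `d`)
  set G : ℕ → ℝ := fun d => ∑ m ∈ Icc 1 (N / d), (m : ℝ) ^ (-β) * (1 - (d : ℝ) * m / N)
    with hG_def
  set M₁ : ℝ := (N : ℝ) ^ u / (u * (2 - β)) with hM₁_def
  set C : ℝ := ∑ m ∈ Icc 1 N, (m : ℝ) ^ (-β) - (N : ℝ) ^ u / u with hC_def
  -- (1) split the sum into three window sums
  have hsplit : ∑ d ∈ Ioc N₀ N, (χ (d : ZMod q)).re * (d : ℝ) ^ (-β) *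
      (G d - ((N : ℝ) / d) ^ u / (u * (2 - β)) - C) =
      ∑ d ∈ Ioc N₀ N, (χ (d : ZMod q)).re * ((d : ℝ) ^ (-β) * G d)
        - M₁ * ∑ d ∈ Ioc N₀ N, (χ (d : ZMod q)).re * (1 / (d : ℝ))
        - C * ∑ d ∈ Ioc N₀ N, (χ (d : ZMod q)).re * (d : ℝ) ^ (-β) := by
    rw [Finset.mul_sum, Finset.mul_sum, ← Finset.sum_sub_distrib, ← Finset.sum_sub_distrib]
    refine Finset.sum_congr rfl fun d hd => ?_
    have hd1 : (0 : ℝ) < d := by exact_mod_cast (Nat.zero_le N₀).trans_lt (Finset.mem_Ioc.mp hd).1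
    have key := rpow_neg_mul_div_rpow (β := β) hd1 hNpos.le
    rw [← hu_def] at key
    have hu2 : u * (2 - β) ≠ 0 := mul_ne_zero hu0.ne' (by linarith)
    rw [hM₁_def]
    linear_combination (-((χ (d : ZMod q)).re / (u * (2 - β)))) * key
  show |∑ d ∈ Ioc N₀ N, (χ (d : ZMod q)).re * (d : ℝ) ^ (-β) *
      (G d - ((N : ℝ) / d) ^ u / (u * (2 - β)) - C)| ≤
      2 * B * A * (A * Λ + 3) / (u * ((N₀ : ℝ) + 1))
  rw [hsplit]
  -- (2) the three Abel bounds
  have hT1 : |∑ d ∈ Ioc N₀ N, (χ (d : ZMod q)).re * ((d : ℝ) ^ (-β) * G d)| ≤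
      2 * B * (((N₀ + 1 : ℕ) : ℝ) ^ (-β) * G (N₀ + 1)) := by
    refine FI2018.abs_sum_Ioc_re_mul_le_of_bound χ hq hB (a := fun d => (d : ℝ) ^ (-β) * G d)
      (N := N₀) (fun n _ => ?_) (fun n hn => ?_) N
    · exact mul_nonneg (Real.rpow_nonneg (Nat.cast_nonneg n) _) (riesz_inner_nonneg β n)
    · have hn1 : 1 ≤ n := by omega
      have hn0 : (0 : ℝ) < n := by exact_mod_cast hn1
      have hGn0 : 0 ≤ G n := riesz_inner_nonneg β n
      have hmono : G (n + 1) ≤ G n := by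
        simp only [hG_def]
        exact riesz_inner_antitone hn1
      have hpow : ((n + 1 : ℕ) : ℝ) ^ (-β) ≤ (n : ℝ) ^ (-β) := by
        push_cast
        exact Real.rpow_le_rpow_of_nonpos hn0 (by linarith) (by linarith)
      calc ((n + 1 : ℕ) : ℝ) ^ (-β) * G (n + 1) ≤ ((n + 1 : ℕ) : ℝ) ^ (-β) * G n :=
            mul_le_mul_of_nonneg_left hmono (Real.rpow_nonneg (Nat.cast_nonneg _) _)
        _ ≤ (n : ℝ) ^ (-β) * G n := mul_le_mul_of_nonneg_right hpow hGn0
  have hT2 : |∑ d ∈ Ioc N₀ N, (χ (d : ZMod q)).re * (1 / (d : ℝ))| ≤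
      2 * B * (1 / ((N₀ + 1 : ℕ) : ℝ)) := by
    refine FI2018.abs_sum_Ioc_re_mul_le_of_bound χ hq hB (a := fun d => 1 / (d : ℝ)) (N := N₀)
      (fun n _ => by positivity) (fun n hn => ?_) N
    have hn0 : (0 : ℝ) < n := by exact_mod_cast (Nat.zero_le N₀).trans_lt hn
    push_cast
    exact one_div_le_one_div_of_le hn0 (by linarith)
  have hT3 : |∑ d ∈ Ioc N₀ N, (χ (d : ZMod q)).re * (d : ℝ) ^ (-β)| ≤
      2 * B * ((N₀ + 1 : ℕ) : ℝ) ^ (-β) := by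
    refine FI2018.abs_sum_Ioc_re_mul_le_of_bound χ hq hB (a := fun d => (d : ℝ) ^ (-β)) (N := N₀)
      (fun n _ => by positivity) (fun n hn => ?_) N
    have hn0 : (0 : ℝ) < n := by exact_mod_cast (Nat.zero_le N₀).trans_lt hn
    push_cast
    exact Real.rpow_le_rpow_of_nonpos hn0 (by linarith) (by linarith)
  -- (3) sizes of the weights at `N₀ + 1`
  have hpow : ((N₀ + 1 : ℕ) : ℝ) ^ (-β) ≤ A / ((N₀ : ℝ) + 1) := by
    push_cast
    exact rpow_neg_le_div hβ1 hNu hN₀1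
  have hGle : G (N₀ + 1) ≤ 1 + A * (Λ / u) := by
    have hM1 : 1 ≤ N / (N₀ + 1) := (Nat.le_div_iff_mul_le (Nat.succ_pos N₀)).mpr (by simpa using hN₀1)
    have hM : (N / (N₀ + 1) : ℕ) ≤ N := Nat.div_le_self N (N₀ + 1)
    have hMpos : (0 : ℝ) < ((N / (N₀ + 1) : ℕ) : ℝ) := by exact_mod_cast hM1
    have hMu : ((N / (N₀ + 1) : ℕ) : ℝ) ^ u ≤ A :=
      (Real.rpow_le_rpow hMpos.le (by exact_mod_cast hM) hu0.le).trans hNu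
    have hlogM : Real.log ((N / (N₀ + 1) : ℕ) : ℝ) ≤ Λ / u :=
      (Real.log_le_log hMpos (by exact_mod_cast hM)).trans hlogN'
    have hlogM0 : 0 ≤ Real.log ((N / (N₀ + 1) : ℕ) : ℝ) := Real.log_nonneg (by exact_mod_cast hM1)
    calc G (N₀ + 1) ≤ ∑ m ∈ Icc 1 (N / (N₀ + 1)), (m : ℝ) ^ (-β) := by
          simp only [hG_def]; exact riesz_inner_le_powerSum β (N₀ + 1)
      _ ≤ 1 + ((N / (N₀ + 1) : ℕ) : ℝ) ^ (1 - β) * Real.log ((N / (N₀ + 1) : ℕ) : ℝ) :=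
          SiegelZero.sum_Icc_rpow_le_log hβ0 hβ1 hM1
      _ ≤ 1 + A * (Λ / u) := by
          rw [← hu_def]
          have := mul_le_mul hMu hlogM hlogM0 hA0
          linarith only [this]
  have hM₁ : 0 ≤ M₁ ∧ M₁ ≤ A / u := by
    have h2 : 1 ≤ 2 - β := by linarith
    constructor
    · rw [hM₁_def]; positivity
    · rw [hM₁_def, div_le_div_iff₀ (by positivity) hu0]
      have hNu' : (N : ℝ) ^ u ≤ A := hNu
      calc (N : ℝ) ^ u * u ≤ A * u := mul_le_mul_of_nonneg_right hNu' hu0.le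
        _ ≤ A * (u * (2 - β)) := by
            apply mul_le_mul_of_nonneg_left _ hA0
            exact le_mul_of_one_le_right hu0.le h2
  have hC : |C| ≤ 1 / u := by
    rw [hC_def, hu_def]; exact SiegelZero.abs_sum_Icc_rpow_sub_le hβ0 hβ1 hN1
  -- (4) combine
  have hGpos : 0 ≤ G (N₀ + 1) := riesz_inner_nonneg β (N₀ + 1)
  have e1 : 2 * B * (((N₀ + 1 : ℕ) : ℝ) ^ (-β) * G (N₀ + 1)) ≤
      2 * B * (A / ((N₀ : ℝ) + 1) * (1 + A * (Λ / u))) := by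
    gcongr
  have e2 : M₁ * |∑ d ∈ Ioc N₀ N, (χ (d : ZMod q)).re * (1 / (d : ℝ))| ≤
      A / u * (2 * B * (1 / ((N₀ : ℝ) + 1))) := by
    have := hT2
    push_cast at this
    exact mul_le_mul hM₁.2 this (abs_nonneg _) (by positivity)
  have e3 : |C| * |∑ d ∈ Ioc N₀ N, (χ (d : ZMod q)).re * (d : ℝ) ^ (-β)| ≤
      1 / u * (2 * B * (A / ((N₀ : ℝ) + 1))) :=
    mul_le_mul hC (hT3.trans (by gcongr)) (abs_nonneg _) (by positivity)
  have habs : |∑ d ∈ Ioc N₀ N, (χ (d : ZMod q)).re * ((d : ℝ) ^ (-β) * G d)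
      - M₁ * ∑ d ∈ Ioc N₀ N, (χ (d : ZMod q)).re * (1 / (d : ℝ))
      - C * ∑ d ∈ Ioc N₀ N, (χ (d : ZMod q)).re * (d : ℝ) ^ (-β)| ≤
      |∑ d ∈ Ioc N₀ N, (χ (d : ZMod q)).re * ((d : ℝ) ^ (-β) * G d)|
      + M₁ * |∑ d ∈ Ioc N₀ N, (χ (d : ZMod q)).re * (1 / (d : ℝ))|
      + |C| * |∑ d ∈ Ioc N₀ N, (χ (d : ZMod q)).re * (d : ℝ) ^ (-β)| := by
    refine (abs_sub _ _).trans ?_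
    refine add_le_add ((abs_sub _ _).trans (add_le_add le_rfl ?_)) ?_
    · rw [abs_mul, abs_of_nonneg hM₁.1]
    · rw [abs_mul]
  refine habs.trans ?_
  refine (add_le_add (add_le_add (hT1.trans e1) e2) e3).trans ?_
  have hkey : 2 * B * (A / ((N₀ : ℝ) + 1) * (1 + A * (Λ / u)))
      + A / u * (2 * B * (1 / ((N₀ : ℝ) + 1)))
      + 1 / u * (2 * B * (A / ((N₀ : ℝ) + 1)))
      = 2 * B * A * (u + A * Λ + 2) / (u * ((N₀ : ℝ) + 1)) := by
    field_simp
    ring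
  rw [hkey]
  apply div_le_div_of_nonneg_right _ (by positivity)
  have h2BA : 0 ≤ 2 * B * A := by positivity
  have : u + A * Λ + 2 ≤ A * Λ + 3 := by linarith only [hu1]
  exact mul_le_mul_of_nonneg_left this h2BA

/-! ### §5. The two Dirichlet-series tails (trivial partial-sum bound `q`) -/

/-- `Σ_{d ≤ N} Re χ(d) · d^{−σ} ≥ Re L(σ, χ) − 2q (N+1)^{−σ}` for quadratic `χ ≠ χ₀`, `σ > 0`
(the tree's `DirichletAbel.abs_re_LFunction_sub_sum_le`, re-indexed).
[cite: MontgomeryVaughan2007, §4.3 (4.23) and Thm. 4.8] -/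
theorem re_LFunction_sub_le_sum_Icc {q : ℕ} [NeZero q] (χ : DirichletCharacter ℂ q) (hχ : χ ≠ 1)
    (hq : χ ^ 2 = 1) {σ : ℝ} (hσ : 0 < σ) (N : ℕ) :
    (χ.LFunction σ).re - 2 * q * (((N + 1 : ℕ) : ℝ)) ^ (-σ) ≤
      ∑ d ∈ Icc 1 N, (χ (d : ZMod q)).re * (d : ℝ) ^ (-σ) := by
  have h := DirichletAbel.abs_re_LFunction_sub_sum_le χ hχ hq hσ N
  have e : ∑ n ∈ Ioc 0 N, reChar χ n * (n : ℝ) ^ (-σ) =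
      ∑ d ∈ Icc 1 N, (χ (d : ZMod q)).re * (d : ℝ) ^ (-σ) := by
    have hI : Finset.Icc 1 N = Finset.Ioc 0 N := by
      ext n; simp only [Finset.mem_Icc, Finset.mem_Ioc]; omega
    rw [hI]
    refine Finset.sum_congr rfl fun n hn => ?_
    rw [DirichletAbel.reChar_apply χ (by have := (Finset.mem_Ioc.mp hn).1; omega)]
  rw [e] at h
  have := (abs_le.mp h).2
  linarith

/-- `|Σ_{d ≤ N} Re χ(d)/d − Re L(1, χ)| ≤ 2q/N` for quadratic `χ ≠ χ₀` and `N ≥ 1` (the tree's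
`DirichletAbel.abs_re_LFunction_one_sub_sum_floor_le` at `t = N`).
[cite: MontgomeryVaughan2007, §4.3 (4.23) and Thm. 4.8] -/
theorem abs_sum_Icc_re_div_sub_re_LFunction_one_le {q : ℕ} [NeZero q] (χ : DirichletCharacter ℂ q)
    (hχ : χ ≠ 1) (hq : χ ^ 2 = 1) {N : ℕ} (hN : 1 ≤ N) :
    |∑ d ∈ Icc 1 N, (χ (d : ZMod q)).re / d - (χ.LFunction 1).re| ≤ 2 * q / (N : ℝ) := by
  have hNpos : (0 : ℝ) < N := by exact_mod_cast hN
  have h := DirichletAbel.abs_re_LFunction_one_sub_sum_floor_le χ hχ hq hNpos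
  rw [Nat.floor_natCast] at h
  have e : ∑ n ∈ Ioc 0 N, reChar χ n / (n : ℝ) = ∑ d ∈ Icc 1 N, (χ (d : ZMod q)).re / d := by
    have hI : Finset.Icc 1 N = Finset.Ioc 0 N := by
      ext n; simp only [Finset.mem_Icc, Finset.mem_Ioc]; omega
    rw [hI]
    refine Finset.sum_congr rfl fun n hn => ?_
    rw [DirichletAbel.reChar_apply χ (by have := (Finset.mem_Ioc.mp hn).1; omega)]
  rw [e, abs_sub_comm] at h
  exact h

end FI2018

/-! ## Part B. Pintz's Theorem 2

### §6. Numerical bookkeeping for the choice `N = ⌊10⁶ q/u²⌋ + 1`, `u ≤ 10⁻⁴` -/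

namespace Pintz1977RealZeros

/-- `log x ≤ 2 √x` for `x > 0` (from `log t ≤ t − 1` at `t = √x`). [folklore] -/
private theorem log_le_two_mul_sqrt {x : ℝ} (hx : 0 < x) : Real.log x ≤ 2 * Real.sqrt x := by
  have hs : 0 < Real.sqrt x := Real.sqrt_pos.mpr hx
  have h1 : Real.log (Real.sqrt x) ≤ Real.sqrt x - 1 := Real.log_le_sub_one_of_pos hs
  have h2 : Real.log x = 2 * Real.log (Real.sqrt x) := by
    conv_lhs => rw [← Real.sq_sqrt hx.le]
    rw [Real.log_pow]; norm_num
  rw [h2]; linarith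

/-- For `0 < u ≤ 10⁻⁴`: `u · log(1/u) ≤ 1/50` (`log(1/u) ≤ 2/√u`, `√u ≤ 1/100`). [folklore] -/
private theorem mul_log_inv_le {u : ℝ} (hu0 : 0 < u) (hu : u ≤ 1 / 10000) :
    u * Real.log (1 / u) ≤ 1 / 50 := by
  have h1 : Real.log (1 / u) ≤ 2 * Real.sqrt (1 / u) := log_le_two_mul_sqrt (by positivity)
  have hsq : Real.sqrt (1 / 10000 : ℝ) = 1 / 100 := by
    rw [show (1 / 10000 : ℝ) = (1 / 100) ^ 2 by norm_num]
    exact Real.sqrt_sq (by norm_num)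
  have hsu : Real.sqrt u ≤ 1 / 100 := (Real.sqrt_le_sqrt hu).trans hsq.le
  have hs0 : Real.sqrt u ≠ 0 := (Real.sqrt_pos.mpr hu0).ne'
  have hss : Real.sqrt u * Real.sqrt u = u := Real.mul_self_sqrt hu0.le
  -- `u √(1/u) = √u`
  have e : u * Real.sqrt (1 / u) = Real.sqrt u := by
    rw [one_div, Real.sqrt_inv]
    calc u * (Real.sqrt u)⁻¹ = (Real.sqrt u * Real.sqrt u) * (Real.sqrt u)⁻¹ := by rw [hss]
      _ = Real.sqrt u := by field_simp
  calc u * Real.log (1 / u) ≤ u * (2 * Real.sqrt (1 / u)) := mul_le_mul_of_nonneg_left h1 hu0.le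
    _ = 2 * (u * Real.sqrt (1 / u)) := by ring
    _ = 2 * Real.sqrt u := by rw [e]
    _ ≤ 2 * (1 / 100) := by gcongr
    _ = 1 / 50 := by norm_num

/-- `exp(1 + 1/20) ≤ 3` (`e < 2.7182818286`, `e^{1/20} ≤ 1/(1 − 1/20)`). [folklore] -/
private theorem exp_le_three : Real.exp (1 + 1 / 20) ≤ 3 := by
  rw [Real.exp_add]
  have h1 : Real.exp 1 ≤ 2.7182818286 := Real.exp_one_lt_d9.le
  have h2 : Real.exp (1 / 20) ≤ 1 / (1 - 1 / 20) :=
    Real.exp_bound_div_one_sub_of_interval (by norm_num) (by norm_num)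
  calc Real.exp 1 * Real.exp (1 / 20) ≤ 2.7182818286 * (1 / (1 - 1 / 20)) :=
        mul_le_mul h1 h2 (Real.exp_pos _).le (by norm_num)
    _ ≤ 3 := by norm_num

/-- `e^{−3/2} ≤ 29/100` (from `1 + x + x²/2 ≤ e^x` at `x = 3/2`: `e^{3/2} ≥ 29/8`). [folklore] -/
private theorem exp_neg_three_halves_le : Real.exp (-3 / 2) ≤ 29 / 100 := by
  have h : (1 : ℝ) + 3 / 2 + (3 / 2) ^ 2 / 2 ≤ Real.exp (3 / 2) :=
    Real.quadratic_le_exp_of_nonneg (by norm_num)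
  have hpos : 0 < Real.exp (3 / 2) := Real.exp_pos _
  rw [show (-3 / 2 : ℝ) = -(3 / 2) by ring, Real.exp_neg, inv_eq_one_div,
    div_le_div_iff₀ hpos (by norm_num)]
  nlinarith [h]

/-- The length numerics: for `0 < b ≤ 10⁻⁴`, `D > 1` with `b log D ≤ 1`, and
`N ≤ 2 · 10⁶ D/b²`: `b log N ≤ 21/20` (`log(2·10⁶) ≤ 15`, `b log(1/b) ≤ 1/50`). [folklore] -/
private theorem mul_log_length_le {b D : ℝ} {N : ℕ} (hu0 : 0 < b) (hu4 : b ≤ 1 / 10000)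
    (hD0 : 0 < D) (hblogD : b * Real.log D ≤ 1) (hNpos : (0 : ℝ) < N)
    (hNX2 : (N : ℝ) ≤ 2 * (1000000 * D / b ^ 2)) :
    b * Real.log N ≤ 1 + 1 / 20 := by
  have hb0' : b ≠ 0 := hu0.ne'
  have hN2X : Real.log N ≤ Real.log (2 * (1000000 * D / b ^ 2)) := Real.log_le_log hNpos hNX2
  have hlog2X : Real.log (2 * (1000000 * D / b ^ 2)) =
      Real.log 2000000 + Real.log D + 2 * Real.log (1 / b) := by
    rw [show 2 * (1000000 * D / b ^ 2) = (2000000 : ℝ) * D * (1 / b) ^ 2 by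
        field_simp; ring,
      Real.log_mul (by positivity) (by positivity), Real.log_mul (by positivity) (by positivity),
      Real.log_pow]
    push_cast; ring
  have h2K : Real.log 2000000 ≤ 15 := by
    rw [Real.log_le_iff_le_exp (by positivity)]
    have h27 : (2.7 : ℝ) ≤ Real.exp 1 := by
      have := Real.exp_one_gt_d9; linarith
    have h15 : (2.7 : ℝ) ^ 15 ≤ Real.exp 1 ^ 15 := pow_le_pow_left₀ (by norm_num) h27 15
    rw [← Real.exp_nat_mul] at h15
    norm_num at h15 ⊢
    linarith [h15]
  have hblog1u : b * Real.log (1 / b) ≤ 1 / 50 := mul_log_inv_le hu0 hu4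
  calc b * Real.log N ≤ b * Real.log (2 * (1000000 * D / b ^ 2)) :=
        mul_le_mul_of_nonneg_left hN2X hu0.le
    _ = b * Real.log 2000000 + b * Real.log D + 2 * (b * Real.log (1 / b)) := by
        rw [hlog2X]; ring
    _ ≤ (1 / 10000) * 15 + 1 + 2 * (1 / 50) := by
        have : b * Real.log 2000000 ≤ (1 / 10000) * 15 := by
          have h0 : 0 ≤ Real.log 2000000 := Real.log_nonneg (by norm_num)
          exact mul_le_mul hu4 h2K h0 (by norm_num)
        linarith
    _ ≤ 1 + 1 / 20 := by norm_num

/-- The splitting-point numerics: with `s = √(D N)` and `10⁶ D ≤ b² N` (`b, D, N > 0`):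
`0 < s`, `s < N` (given `D < N`), `s/N ≤ b/1000` and `D/s ≤ b/1000`. [folklore] -/
private theorem sqrt_split_facts {b D s : ℝ} {N : ℕ} (hu0 : 0 < b) (hD0 : 0 < D)
    (hNpos : (0 : ℝ) < N) (hDN : D < N) (hKDN : 1000000 * D ≤ b ^ 2 * N)
    (hs : s = Real.sqrt (D * N)) :
    0 < s ∧ s < N ∧ s / N ≤ b / 1000 ∧ D / s ≤ b / 1000 := by
  have hs0 : 0 < s := by rw [hs]; exact Real.sqrt_pos.mpr (by positivity)
  have hs2 : s ^ 2 = D * N := by rw [hs]; exact Real.sq_sqrt (by positivity)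
  refine ⟨hs0, ?_, ?_, ?_⟩
  · have : s ^ 2 < (N : ℝ) ^ 2 := by
      rw [hs2, sq]
      exact mul_lt_mul_of_pos_right hDN hNpos
    exact (pow_lt_pow_iff_left₀ hs0.le hNpos.le two_ne_zero).mp this
  · rw [div_le_div_iff₀ hNpos (by norm_num)]
    have h : (s * 1000) ^ 2 ≤ (b * N) ^ 2 := by
      rw [mul_pow, hs2]
      have := mul_le_mul_of_nonneg_right hKDN hNpos.le
      nlinarith only [this]
    exact (pow_le_pow_iff_left₀ (by positivity) (by positivity) two_ne_zero).mp h
  · rw [div_le_div_iff₀ hs0 (by norm_num)]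
    have h : (D * 1000) ^ 2 ≤ (b * s) ^ 2 := by
      rw [mul_pow, mul_pow, hs2]
      have := mul_le_mul_of_nonneg_right hKDN hD0.le
      nlinarith only [this]
    exact (pow_le_pow_iff_left₀ (by positivity) (by positivity) two_ne_zero).mp h

end Pintz1977RealZeros

/-! ### §7. Hecke's theorem with Pintz's constant -/

open FI2018 Pintz1977RealZeros in
/-- **Hecke's theorem with an explicit constant and an explicit absolute threshold** (the kernel
content of Pintz's Theorem 2 as proved here): for `D ≥ ⌈exp 10⁴⌉`, every quadratic `χ ≠ χ₀` mod `D`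
and every `0 < β ≤ 1/log D` such that `L(σ, χ) ≠ 0` for `σ ∈ [1 − β, 1]`:
`(29/100) β ≤ L(1, χ)` (print: `(1 + o(1)) e^{−3/2} β`, `e^{−3/2} ≈ 0.223`). Proof: the elementary
Riesz-mean road described in the module docstring (declared deviation from print's Lemma 2 /
analytic continuation). [cite: Pintz1977ElementaryVIII, Theorem 2 p. 89; proof §4 pp. 95–96 (4.4)] -/
theorem Pintz1977RealZeros.re_LFunction_one_ge_of_forall_ne_zero {D : ℕ} [NeZero D]
    (hD : ⌈Real.exp 10000⌉₊ ≤ D) (χ : DirichletCharacter ℂ D) (hq : χ ^ 2 = 1) (hχ : χ ≠ 1)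
    {b : ℝ} (hb0 : 0 < b) (hb : b ≤ 1 / Real.log D)
    (hz : ∀ σ : ℝ, 1 - b ≤ σ → σ ≤ 1 → χ.LFunction (σ : ℂ) ≠ 0) :
    29 / 100 * b ≤ (χ.LFunction 1).re := by
  -- sizes of `D`
  have hDexp : Real.exp 10000 ≤ (D : ℝ) := (Nat.le_ceil _).trans (by exact_mod_cast hD)
  have hD1 : (1 : ℝ) < D := lt_of_lt_of_le (by have := Real.add_one_le_exp (10000 : ℝ); linarith) hDexp
  have hD0 : (0 : ℝ) < D := by linarith
  have hDnat1 : 1 ≤ D := by exact_mod_cast hD1.le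
  have hlogD : 10000 ≤ Real.log D := by
    rw [Real.le_log_iff_exp_le hD0]; exact hDexp
  have hlogD0 : 0 < Real.log D := by linarith
  -- `u = b ≤ 10⁻⁴`
  have hu4 : b ≤ 1 / 10000 := by
    refine hb.trans ?_
    rw [div_le_div_iff₀ hlogD0 (by norm_num)]
    linarith
  have hu0 : 0 < b := hb0
  have hu3 : b ≤ 1 / 3 := hu4.trans (by norm_num)
  have hu1 : b < 1 := by linarith
  -- the exponent `β' = 1 − b`
  set β' : ℝ := 1 - b with hβ'_def
  have hβ' : 2 / 3 ≤ β' := by rw [hβ'_def]; linarith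
  have hβ'1 : β' < 1 := by rw [hβ'_def]; linarith
  have hβ'0 : 0 < β' := by linarith
  have huβ : 1 - β' = b := by rw [hβ'_def]; ring
  -- the length `N = ⌊10⁶ D/b²⌋ + 1`
  set X : ℝ := 1000000 * D / b ^ 2 with hX_def
  have hb2 : 0 < b ^ 2 := by positivity
  have hb0' : b ≠ 0 := hu0.ne'
  have hbsq1 : b ^ 2 ≤ 1 := pow_le_one₀ hu0.le hu1.le
  have hX1 : 1 ≤ X := by
    rw [hX_def, le_div_iff₀ hb2, one_mul]
    calc b ^ 2 ≤ 1 := hbsq1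
      _ ≤ D := hD1.le
      _ ≤ 1000000 * D := by linarith only [hD1]
  have hX0 : 0 < X := by linarith
  set N : ℕ := ⌊X⌋₊ + 1 with hN_def
  have hNX : X ≤ N := by rw [hN_def]; push_cast; exact (Nat.lt_floor_add_one X).le
  have hNX2 : (N : ℝ) ≤ 2 * X := by
    rw [hN_def]; push_cast
    have := Nat.floor_le hX0.le
    linarith only [this, hX1]
  have hN1 : 1 ≤ N := by omega
  have hNpos : (0 : ℝ) < N := by exact_mod_cast hN1
  -- `10⁶ D ≤ b² N`
  have hKDN : 1000000 * D ≤ b ^ 2 * N := by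
    have e : X * b ^ 2 = 1000000 * D := by rw [hX_def]; field_simp
    calc (1000000 : ℝ) * D = X * b ^ 2 := e.symm
      _ ≤ N * b ^ 2 := mul_le_mul_of_nonneg_right hNX hb2.le
      _ = b ^ 2 * N := mul_comm _ _
  -- `N^b ≤ 3` (hence `A = 3`) and `b log N ≤ 2` (hence `Λ = 2`)
  have hblogD : b * Real.log D ≤ 1 := by
    have := hb
    rwa [le_div_iff₀ hlogD0] at this
  have hlogN : b * Real.log N ≤ 1 + 1 / 20 :=
    mul_log_length_le hu0 hu4 hD0 hblogD hNpos (by rw [hX_def] at hNX2; exact hNX2)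
  have hNu : (N : ℝ) ^ (1 - β') ≤ 3 := by
    rw [huβ, Real.rpow_def_of_pos hNpos, mul_comm]
    exact (Real.exp_le_exp.mpr hlogN).trans exp_le_three
  have hΛ : (1 - β') * Real.log N ≤ 2 := by rw [huβ]; linarith
  -- the constant `C_N` and its sign
  set C : ℝ := ∑ m ∈ Icc 1 N, (m : ℝ) ^ (-β') - (N : ℝ) ^ (1 - β') / (1 - β') with hC_def
  have hCneg : C ≤ 1 - 1 / b := by
    have h := (powerSum_sub_main_antitone hβ'0.le hβ'1 (le_refl 1) hN1).1
    simp only [Finset.Icc_self, Finset.sum_singleton, Nat.cast_one, Real.one_rpow] at h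
    rw [huβ] at h
    rw [hC_def, huβ]
    linarith
  have hCle0 : C ≤ 0 := by
    have : 1 / b ≥ 1 := by rw [ge_iff_le, one_le_div hu0]; exact hu1.le
    linarith only [hCneg, this]
  have hCabs : |C| ≤ 1 / b := by
    rw [hC_def, ← huβ]; exact SiegelZero.abs_sum_Icc_rpow_sub_le hβ'0.le hβ'1 hN1
  have hCge : -(1 / b) ≤ C := (abs_le.mp hCabs).1
  -- the three pieces of the decomposition
  have hdec := smoothSum_decomposition_general χ hβ'1 N
  set S₁ : ℝ := ∑ d ∈ Icc 1 N, (χ (d : ZMod D)).re / d with hS₁_def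
  set S₂ : ℝ := ∑ d ∈ Icc 1 N, (χ (d : ZMod D)).re * (d : ℝ) ^ (-β') with hS₂_def
  set R : ℝ := ∑ d ∈ Icc 1 N, (χ (d : ZMod D)).re * (d : ℝ) ^ (-β') *
      (∑ m ∈ Icc 1 (N / d), (m : ℝ) ^ (-β') * (1 - (d : ℝ) * m / N)
        - ((N : ℝ) / d) ^ (1 - β') / ((1 - β') * (2 - β'))
        - (∑ m ∈ Icc 1 N, (m : ℝ) ^ (-β') - (N : ℝ) ^ (1 - β') / (1 - β'))) with hR_def
  set M₁ : ℝ := (N : ℝ) ^ (1 - β') / ((1 - β') * (2 - β')) with hM₁_def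
  have hS : FI2018.smoothSum χ β' N = M₁ * S₁ + C * S₂ + R := hdec
  -- (a) `S ≥ 1 − 1/N`
  have hSlow : 1 - 1 / (N : ℝ) ≤ FI2018.smoothSum χ β' N := one_sub_inv_le_smoothSum χ hq β' hN1
  -- (b) `S₁ ≤ L(1) + 2D/N`
  set L₁ : ℝ := (χ.LFunction 1).re with hL₁_def
  have hS₁ : S₁ ≤ L₁ + 2 * D / N := by
    have h := abs_sum_Icc_re_div_sub_re_LFunction_one_le χ hχ hq hN1
    have := (abs_le.mp h).2
    rw [hS₁_def, hL₁_def]; linarith only [this]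
  -- (c) `C S₂ ≤ (1/b) · 2D (N+1)^{−β'} ≤ 6D/(b N)`
  have hLσ : 0 < (χ.LFunction (β' : ℂ)).re :=
    DirichletAbel.LFunction_ofReal_re_pos_of_forall_ne_zero χ hχ hq hβ'0 hβ'1.le
      (fun σ h1 h2 => hz σ (by simpa only [hβ'_def] using h1) h2)
  have hS₂ : (χ.LFunction (β' : ℂ)).re - 2 * D * (((N + 1 : ℕ) : ℝ)) ^ (-β') ≤ S₂ :=
    re_LFunction_sub_le_sum_Icc χ hχ hq hβ'0 N
  have hT₂ : (((N + 1 : ℕ) : ℝ)) ^ (-β') ≤ 3 / N := by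
    have h1 : (((N + 1 : ℕ) : ℝ)) ^ (-β') ≤ (N : ℝ) ^ (-β') := by
      push_cast
      exact Real.rpow_le_rpow_of_nonpos hNpos (by linarith) (by linarith)
    have h2 : (N : ℝ) ^ (-β') = (N : ℝ) ^ (1 - β') / N := by
      rw [show -β' = (1 - β') - 1 by ring, Real.rpow_sub hNpos, Real.rpow_one]
    rw [h2] at h1
    exact h1.trans (div_le_div_of_nonneg_right hNu hNpos.le)
  have hCS₂ : C * S₂ ≤ 6 * D / (b * N) := by
    -- `C ≤ 0` and `S₂ ≥ Lσ − T`, so `C S₂ ≤ C (Lσ − T) ≤ −C T ≤ (1/b) T`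
    have hT0 : 0 ≤ 2 * (D : ℝ) * (((N + 1 : ℕ) : ℝ)) ^ (-β') := by positivity
    have h1 : C * S₂ ≤ C * ((χ.LFunction (β' : ℂ)).re - 2 * D * (((N + 1 : ℕ) : ℝ)) ^ (-β')) :=
      mul_le_mul_of_nonpos_left hS₂ hCle0
    have h2 : C * ((χ.LFunction (β' : ℂ)).re - 2 * D * (((N + 1 : ℕ) : ℝ)) ^ (-β')) ≤
        (1 / b) * (2 * D * (((N + 1 : ℕ) : ℝ)) ^ (-β')) := by
      have : C * (χ.LFunction (β' : ℂ)).re ≤ 0 := mul_nonpos_of_nonpos_of_nonneg hCle0 hLσ.le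
      have hprod : 0 ≤ (C + 1 / b) * (2 * D * (((N + 1 : ℕ) : ℝ)) ^ (-β')) :=
        mul_nonneg (by linarith only [hCge]) hT0
      nlinarith only [this, hprod, hT0]
    have h3 : (1 / b) * (2 * D * (((N + 1 : ℕ) : ℝ)) ^ (-β')) ≤ (1 / b) * (2 * D * (3 / N)) := by
      gcongr
    calc C * S₂ ≤ (1 / b) * (2 * D * (3 / N)) := (h1.trans h2).trans h3
      _ = 6 * D / (b * N) := by field_simp; ring
  -- (d) the error `R`: split at `N₀ = ⌊√(D N)⌋`
  set s : ℝ := Real.sqrt ((D : ℝ) * N) with hs_def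
  have hDN : (D : ℝ) < N := by
    -- `N ≥ 10⁶ D/b² ≥ 10⁶ D > D`
    have : (1000000 : ℝ) * D ≤ N := by
      calc (1000000 : ℝ) * D ≤ b ^ 2 * N := hKDN
        _ ≤ 1 * N := mul_le_mul_of_nonneg_right hbsq1 hNpos.le
        _ = N := one_mul _
    linarith only [this, hD0]
  obtain ⟨hs0, hsN, hsN', hDs⟩ := sqrt_split_facts hu0 hD0 hNpos hDN hKDN hs_def
  set N₀ : ℕ := ⌊s⌋₊ with hN₀_def
  have hN₀s : (N₀ : ℝ) ≤ s := Nat.floor_le hs0.le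
  have hsN₀ : s < (N₀ : ℝ) + 1 := Nat.lt_floor_add_one s
  have hN₀N : N₀ < N := by
    have : (N₀ : ℝ) < N := lt_of_le_of_lt hN₀s hsN
    exact_mod_cast this
  have hB : ∀ n, ‖partialSum χ n‖ ≤ (D : ℝ) := fun n => DirichletAbel.norm_partialSum_le χ hχ n
  have hRsplit : R = ∑ d ∈ Icc 1 N₀, (χ (d : ZMod D)).re * (d : ℝ) ^ (-β') *
        (∑ m ∈ Icc 1 (N / d), (m : ℝ) ^ (-β') * (1 - (d : ℝ) * m / N)
          - ((N : ℝ) / d) ^ (1 - β') / ((1 - β') * (2 - β'))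
          - (∑ m ∈ Icc 1 N, (m : ℝ) ^ (-β') - (N : ℝ) ^ (1 - β') / (1 - β')))
      + ∑ d ∈ Ioc N₀ N, (χ (d : ZMod D)).re * (d : ℝ) ^ (-β') *
        (∑ m ∈ Icc 1 (N / d), (m : ℝ) ^ (-β') * (1 - (d : ℝ) * m / N)
          - ((N : ℝ) / d) ^ (1 - β') / ((1 - β') * (2 - β'))
          - (∑ m ∈ Icc 1 N, (m : ℝ) ^ (-β') - (N : ℝ) ^ (1 - β') / (1 - β'))) := by
    have hI : ∀ M : ℕ, Finset.Icc 1 M = Finset.Ioc 0 M := fun M => by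
      ext n; simp only [Finset.mem_Icc, Finset.mem_Ioc]; omega
    rw [hR_def, hI, hI, ← Finset.sum_Ioc_consecutive _ (Nat.zero_le N₀) hN₀N.le]
  have hRlong := abs_longRange_le_general χ hβ' hβ'1 (A := 3) (Λ := 2) (by norm_num) (by norm_num)
    hNu hΛ hN₀N.le
  have hRshort := abs_shortRange_le_general χ hq hB hβ' hβ'1 (A := 3) (Λ := 2) (by norm_num)
    hNu hΛ hN₀N
  -- numerics of the two ranges: `51 N₀/(b N) ≤ 51/1000`, `54 D/(b (N₀+1)) ≤ 54/1000`
  have hRabs : |R| ≤ 51 / 1000 + 54 / 1000 := by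
    rw [hRsplit]
    refine (abs_add_le _ _).trans (add_le_add (hRlong.trans ?_) (hRshort.trans ?_))
    · -- `(3·5+2)·3·N₀/(b N) = 51 N₀/(bN) ≤ 51 s/(bN) ≤ 51/1000`
      rw [huβ]
      have e : ((3 : ℝ) * (3 + 2) + 2) * 3 * N₀ / (b * N) = 51 * ((N₀ : ℝ) / N) / b := by
        field_simp; ring
      rw [e, div_le_iff₀ hu0]
      have : (N₀ : ℝ) / N ≤ b / 1000 := (div_le_div_of_nonneg_right hN₀s hNpos.le).trans hsN'
      linarith only [this]
    · -- `2·D·3·(3·2+3)/(b (N₀+1)) = 54 D/(b(N₀+1)) ≤ 54 D/(b s) ≤ 54/1000`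
      rw [huβ]
      have hN₀1 : (0 : ℝ) < (N₀ : ℝ) + 1 := by positivity
      have e : (2 : ℝ) * D * 3 * (3 * 2 + 3) / (b * ((N₀ : ℝ) + 1)) =
          54 * ((D : ℝ) / ((N₀ : ℝ) + 1)) / b := by
        field_simp; ring
      rw [e, div_le_iff₀ hu0]
      have : (D : ℝ) / ((N₀ : ℝ) + 1) ≤ b / 1000 :=
        (div_le_div_of_nonneg_left hD0.le hs0 hsN₀.le).trans hDs
      linarith only [this]
  -- (e) assemble: `1 − 1/N ≤ M₁ (L₁ + 2D/N) + 6D/(bN) + 0.105`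
  have hM₁0 : 0 < M₁ := by
    rw [hM₁_def]
    exact div_pos (Real.rpow_pos_of_pos hNpos _) (mul_pos (by linarith only [hβ'1]) (by linarith only [hβ'1]))
  have hM₁le : M₁ ≤ 3 / b := by
    -- `M₁ = N^b/(b (1+b)) ≤ 3/(b(1+b)) ≤ 3/b`
    rw [hM₁_def, huβ, show 2 - β' = 1 + b by rw [hβ'_def]; ring]
    rw [div_le_div_iff₀ (by positivity) hu0]
    have hNu' : (N : ℝ) ^ b ≤ 3 := by rw [← huβ]; exact hNu
    calc (N : ℝ) ^ b * b ≤ 3 * b := mul_le_mul_of_nonneg_right hNu' hu0.le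
      _ ≤ 3 * (b * (1 + b)) := by nlinarith only [hu0]
  have h1N : 1 / (N : ℝ) ≤ 1 / 1000000 := by
    -- `N ≥ K D/b² ≥ K`
    have : (1000000 : ℝ) ≤ N := by
      have hD1' : (1 : ℝ) ≤ D := hD1.le
      calc (1000000 : ℝ) ≤ 1000000 * D := le_mul_of_one_le_right (by norm_num) hD1'
        _ ≤ b ^ 2 * N := hKDN
        _ ≤ 1 * N := mul_le_mul_of_nonneg_right hbsq1 hNpos.le
        _ = N := one_mul _
    exact one_div_le_one_div_of_le (by norm_num) this
  have hDN' : (D : ℝ) / N ≤ b ^ 2 / 1000000 := by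
    rw [div_le_div_iff₀ hNpos (by norm_num)]
    linarith only [hKDN]
  have hb2small : b ^ 2 ≤ b * (1 / 10000) := by nlinarith only [hu4, hu0]
  -- main inequality
  have hmain : 1 - 1 / (N : ℝ) ≤ M₁ * (L₁ + 2 * D / N) + 6 * D / (b * N) + (51 / 1000 + 54 / 1000) := by
    have hR' := (abs_le.mp hRabs).2
    have hM₁S₁ : M₁ * S₁ ≤ M₁ * (L₁ + 2 * D / N) := mul_le_mul_of_nonneg_left hS₁ hM₁0.le
    linarith only [hSlow, hS, hM₁S₁, hCS₂, hR']
  -- `6D/(bN) ≤ 6 b/10⁶`, `2D/N ≤ 2b²/10⁶`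
  have h6 : 6 * (D : ℝ) / (b * N) ≤ 6 / 1000000 * b := by
    have e : 6 * (D : ℝ) / (b * N) = 6 * ((D : ℝ) / N) / b := by field_simp
    rw [e, div_le_iff₀ hu0]
    nlinarith only [hDN']
  have h2DN : 2 * (D : ℝ) / N ≤ 2 / 1000000 * b ^ 2 := by
    have e : 2 * (D : ℝ) / N = 2 * ((D : ℝ) / N) := by ring
    rw [e]; linarith only [hDN']
  -- from `hmain`: `M₁ (L₁ + 2D/N) ≥ 0.89`, so `L₁ + 2D/N ≥ 0.89/M₁ ≥ 0.89 b/3`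
  have hML : (89 / 100 : ℝ) ≤ M₁ * (L₁ + 2 * D / N) := by
    have hb6 : 6 / 1000000 * b ≤ 1 / 1000000 := by linarith only [hu4]
    linarith only [hmain, h1N, h6, hb6]
  have hLb : (89 / 100) * (b / 3) ≤ L₁ + 2 * D / N := by
    -- divide by `M₁ ≤ 3/b`
    have hpos : 0 < L₁ + 2 * D / N := by
      by_contra hcon
      have hle : L₁ + 2 * D / N ≤ 0 := not_lt.mp hcon
      have : M₁ * (L₁ + 2 * D / N) ≤ 0 := mul_nonpos_of_nonneg_of_nonpos hM₁0.le hle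
      linarith only [hML, this]
    have h1 : (89 / 100 : ℝ) ≤ (3 / b) * (L₁ + 2 * D / N) :=
      hML.trans (mul_le_mul_of_nonneg_right hM₁le hpos.le)
    have h2 : (3 / b) * (L₁ + 2 * D / N) = (L₁ + 2 * D / N) / (b / 3) := by
      field_simp
    rw [h2, le_div_iff₀ (by positivity)] at h1
    linarith only [h1]
  have hL₁ : (29 / 100) * b ≤ L₁ := by
    have : 2 / 1000000 * b ^ 2 ≤ 2 / 1000000 * (b * (1 / 10000)) := by linarith only [hb2small]
    linarith only [hLb, h2DN, this, hu0]
  exact hL₁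

open Pintz1977RealZeros in
/-- **Pintz 1977 (VIII), Theorem 2 (Hecke) — PROVED.** For every `η > 0` there is `D₀` (here the
absolute `D₀ = ⌈exp 10⁴⌉`, independent of `η`) such that for `D ≥ D₀`, every real non-principal
`χ` mod `D` and every `0 < β ≤ 1/log D` with `L(σ, χ) ≠ 0` on `[1 − β, 1]`:
`(1 − η) e^{−3/2} β < L(1, χ)` — from `re_LFunction_one_ge_of_forall_ne_zero` (`0.29 > e^{−3/2}`).
[cite: Pintz1977ElementaryVIII, Theorem 2 p. 89; proof §4 pp. 95–96 (4.4)] -/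
theorem pintz1977RealZeros_theorem2_holds : pintz1977RealZeros_theorem2 := by
  intro η hη
  refine ⟨⌈Real.exp 10000⌉₊, fun D _ hD χ hquad hχ b hb0 hb hz => ?_⟩
  have hL₁ := re_LFunction_one_ge_of_forall_ne_zero hD χ hquad.sq_eq_one hχ hb0 hb hz
  -- `(1 − η) e^{−3/2} b < e^{−3/2} b ≤ (29/100) b ≤ Re L(1, χ)`
  have hexp := exp_neg_three_halves_le
  have hpos : 0 < Real.exp (-3 / 2) * b := mul_pos (Real.exp_pos _) hb0
  calc (1 - η) * Real.exp (-3 / 2) * b < 1 * Real.exp (-3 / 2) * b := by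
        have : (1 - η) * (Real.exp (-3 / 2) * b) < 1 * (Real.exp (-3 / 2) * b) :=
          mul_lt_mul_of_pos_right (by linarith only [hη]) hpos
        simpa [mul_assoc] using this
    _ ≤ 29 / 100 * b := by rw [one_mul]; exact mul_le_mul_of_nonneg_right hexp hb0.le
    _ ≤ (χ.LFunction 1).re := hL₁

end Literature.NumberTheory.LFunctions
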